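import Literature.MathematicalPhysics.QuantumFieldTheory.Balaban1983to89.B9SupplySockB9P3ZdGammaUniv
import Literature.MathematicalPhysics.QuantumFieldTheory.Balaban1983to89.B9SupplySockB9P3ZdGammaInAk

/-!
# `Balaban1983to89.B9SupplySockB9P3ZdGammaUnivInAk` — [Balaban1985BackgroundPropagators] (3.69) p. 404, Thm 3.3 p. 399 ∕ [Balaban1985RegularSpaces] (1.7) p. 77,
# (1.58)–(1.59) p. 86, Thm 8 p. 101: EDITION γ·InAk ON THE `Ω₀ = ℤᵈ` ROAD — the univ-road suppliers of `B9SupplySockB9P3ZdGammaUniv` re-derived with the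
# Δ′-binder in the socket's own 𝔄-currency (`B9SupplySockB9P3ZdGammaInAk.CurvAtInAk`), so that dag-n06-w2's genuine letter `DpZd` fills the Δ′-slot by name

statement-level skeleton of published theorems with citation tags; proofs where landed; nothing here is a claim about the
Yang–Mills mass gap

`[Balaban1985BackgroundPropagators]` ("[4]", CMP **99** (1985) 389–434) (3.69) p. 404, (3.16) p. 393, (3.20)–(3.27) pp. 394–395, Thm 3.3 p. 399, (3.43)∕(3.47) p. 398;
`[Balaban1985RegularSpaces]` ("B8", CMP **99** (1985) 75–102) (1.7) p. 77, (1.31) p. 82, (1.56)–(1.59) p. 86, Prop. 3 p. 87, Thm 8 + (1.146) p. 101; `[Balaban1984PropagatorsII]`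
(2.3) p. 224.  PDF held: `paper:balaban1985-cmp99-background-propagators`, `paper:balaban1985-cmp99-regular-spaces-gauge-fixing`.

WHY THIS FILE (cell `pub-ymgap`, seat `pub-ymgap-dag-n06-b` g16; companion of `B9SupplySockB9P3ZdGammaInAk` (cube road); dag-n06-w2's preference (ii);
count-neutral).  Same change as the companion, on the `Ω₀ = ℤᵈ` road: the curvature binder `CurvAt` (frame's (3.35) class at scale `K₆α₀`) is replaced by
`CurvAtInAk` (the socket's own datum `InAk … α₀ … U₀`), and the five-line supplier, the sourced∕guarded supplier, the three explicit-constant family forms the N05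
record knits consume, and the A6 witness are re-derived at it — the threshold's last entry loses its `K₆` (`cP = min{1∕16, c₆∕M, a₀∕(K₆M), a₃∕(K₆M), 1∕(2B₀c₆₉M+1)}`),
every other constant unchanged.

WHAT IS PROVED (kernel, 0 sorry; theorems only; no `instance`, no `notation`).
* ★ `sockB9P3PI_at_univ` (= `…GammaUniv.sockB9P3P_at_univ` with `hcurv : CurvAtInAk …`) · ★ `sockSrc_core_at_univ_linPI` (= `…sockSrc_core_at_univ_linP`) ·
  `sockB9P3PI_allLevels_univ_explicit_on` (`SB9all`) · `sockB9P3srcHPI_univ_explicit_on_lin` (`SB9srcH`) · `sockH59srcPI_univ_explicit_on_lin` (`SH59src`) ·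
  A6 ★★ `binders_inhabited_univ_zero_linPI` (the ten letters with `CurvAtInAk` + `AvgAtP … ΛbP` at `(1, i, 0)`; `Δ′ := 0`; `opsU ∕ geoU ∕ GAU` by import).

HONEST SCOPE.  Re-typing + re-derivation + A6 at `m = 0`; 0 estimates of [4]∕[B8] (the genuine Δ′ is dag-n06-w2's); the member-generic print class of a lawful
`Ω₀ = ℤᵈ` member and the `m ≥ 1` inhabitation remain open as declared in the companions; count-neutral; N05∕N06 NOT discharged; nothing continuum ∕ ℝ⁴ ∕ OS ∕
mass-gap ∕ Clay.  Unit `pub-ymgap-dag-n06-b` (g16), 2026-08-27.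
-/

noncomputable section

open NormedSpace

namespace Literature.MathematicalPhysics.QuantumFieldTheory.Balaban1983to89.B9SupplySockB9P3ZdGammaUnivInAk

open Complex (I)
open MatrixLog B7Prop1Explicit B7Prop2Explicit B7Prop1Local B7Eq92Concrete
open B7Prop4GeneralLevels (linCovIter)
open B7Eq78Linearization (conjR)
open B8Ineq132 (covDerivFwd covDeriv InAk BondTouches)
open B8Eq119TwistedAxial (Restr129 InAx)
open B8Eq184Proof (cfgExp)
open B8Lemma1NonAbelian (mulCfg)
open B8Eq140Level (SideTouches)
open B8Eq146AExpansion (iEta plaqCovDeriv)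
open B8Eq143PlaqExpansion (pdiv)
open B8Eq155JBound (Jcur wsup)
open B8ScaledSupNorm (bondNorm msup weight Bdd)
open B8Eq138LandauZd (IsLandau138 IsLandau138W IsLandau146 IsLandau146W InR138 QT covDivB logCfg covLap)
open B8LanF146 (LanF146)
open B8LeafModelZd (ZdIdx)
open B8LeafModelZd3 (SockB9P3)
open B9Eq340HolderZd (hquot AdmPair trans)
open B9SupplySockB9P3ZdLetters (OpsZd deltaAOf DictGlob Prop6Feed HolderGlob)
open B9SupplySockB9P3ZdLettersOmega (OnDom restrictDom outerPart Margin2 InvOnDom CurvSmallDom LandauKillsDom AvgBoundDom SockB9P3D4)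
open B9SupplySockB9P3ZdOmega (collar_arith)
open B9SupplySockB9P3ZdSrc (GopAdd SourceTermDom SourceHolderDom msup_eq_zero_of_not_bdd msup_le_add_of_norm_le hquot_add_le hquot_sub_le trans_add
  apriori_arith_src)
open B9SupplySockB9P3ZdAt (DictAt Prop6At InvAt CurvAt LandauAt AvgAt HolderAt GopAddAt SrcAt SrcHolderAt)
open B9SupplySockB9P3ZdAtLin (LinBddAt)
open B9SupplySockB9P3ZdUnivWitness (BddF)
open B9SupplySockB9P3ZdGammaUniv (AvgAtP)
open B9SupplySockB9P3ZdGammaInAk (CurvAtInAk)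
open B8Prop3GaugeFixedKLevel (mem_unitaryUnits_of_mgauge_eq mulCfg_eq_gaugeAct_of_mgauge_eq)

-- `Site` alone could resolve to the torus sites of `Setup.lean`; re-export the `ℤ^d` sites of `B7Prop1Explicit`.
export B7Prop1Explicit (Site)

variable {d : ℕ} {𝔸 : Type*} [CStarAlgebra 𝔸]
/-! ## §2–§4 The univ-road suppliers at a supplied datum class, Δ′-binder in the 𝔄-currency -/

section Supply

variable [Nontrivial 𝔸]
variable {I : Type} (geo : I → B9.Geometry) (bg : I → B9.Backgrounds) (GA : ∀ i, B9.KernelFamily (geo i) (bg i))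
variable (L : ℕ) (mem : ℝ → ZdIdx d L → ℕ → I)
variable (ιCfg : ∀ (M : ℝ) (i : ZdIdx d L) (m : ℕ) (U₀ : Site d → Fin d → 𝔸ˣ),
  (∀ x κ, U₀ x κ ∈ unitaryUnits 𝔸) → (bg (mem M i m)).Cfg)
variable (ιLoc : ∀ (M : ℝ) (i : ZdIdx d L) (m : ℕ), (Site d → Fin d → 𝔸) → (geo (mem M i m)).Loc)
variable (ops : ℝ → ZdIdx d L → ℕ → OpsZd d 𝔸)

set_option maxHeartbeats 400000 in
/-- ★ **(`CurvAtInAk` currency; threshold without `K₆` in its last entry.)  AT A MEMBER WITH `Ω₀ = ℤᵈ` THEOREM 3.3 SUPPLIES THE FIVE-LINE SOCKET `SockB9P3`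
AT ANY SUPPLIED DATUM CLASS `ΛbP`** — `B9SupplySockB9P3ZdGammaUniv.sockB9P3P_at_univ` with the Δ′ bound taken at the datum's `α₀` from `InAk`; `B9SupplySockB9P3ZdAt.sockB9P3_at_univ'`
re-proved VERBATIM with the averaging datum class an explicit PARAMETER (binder `AvgAtP … ΛbP`, socket `SockB9P3 … ΛbP`) instead of the member's law field
`i.Λb` (at `Ω₀ = ℤᵈ` no locality law is needed: there is no exterior); same constants B₀′ = max{1, 2B₀max{1,q}}, B₀β′ = 2max{0, C_H Bβ(β)}max{1,q},
cP = min{1∕16, c₆∕M, a₀∕(K₆M), a₃∕(K₆M), 1∕(2B₀c₆₉K₆M+1)}.  At `ΛbP :=` print's class [B6] (2.3) ∕ (1.31) of the member this is EDITION γ of the univ-road member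
supplier (the law class `towerBonds` of the `Ω₀ = ℤᵈ` members of record is refuted at `m ≥ 1` by `B8SockB9P3ShellModeVacuityUniv.not_sB9all_idxB8SubB`).
[cite: Balaban1985RegularSpaces, (1.58)–(1.59) p.86, (1.31) p.82, Prop. 3 p.87, p.77; Balaban1985BackgroundPropagators, Thm 3.3 p.399, (3.26)–(3.27) p.395, (3.43), (3.47) p.398, (3.69) p.404; Balaban1984PropagatorsII, (2.3) p.224] -/
theorem sockB9P3PI_at_univ (hd2 : 2 ≤ d) (hL : 1 ≤ L) {c35 c₆ K₆ a₃ c69 q CH β : ℝ} {len : Site d → ℝ}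
    {M : ℝ} (hM1 : 1 ≤ M) (i : ZdIdx d L) (hΩ : i.Ω 0 = Set.univ) (m : ℕ)
    (hdict : DictAt geo bg GA L mem ιCfg ιLoc ops M i m) (hP6 : Prop6At bg L mem ιCfg c35 c₆ K₆ M i m)
    (hinv : InvAt bg L mem ιCfg ops c35 a₃ M i m) (hcurv : CurvAtInAk L ops c69 M i m)
    (hlan : LandauAt bg L mem ιCfg ops c35 a₃ M i m)
    (ΛbP : ℕ → ℕ → Set (Site d × Fin d)) (havg : AvgAtP L ops q ΛbP M i m)
    (hhol : HolderAt geo bg GA L mem ιCfg ops β len CH M i m)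
    (hK₆ : 0 < K₆) (hc69 : 0 ≤ c69) (hq : 0 ≤ q)
    {B₀ δ₀ a₀ : ℝ} {Bβ Bε : ℝ → ℝ} {Bεβ : ℝ → ℝ → ℝ} (hB₀ : 0 < B₀)
    (h33U : ∀ (α₀ : ℝ) (U₀ : Site d → Fin d → 𝔸ˣ) (hU₀ : ∀ x κ, U₀ x κ ∈ unitaryUnits 𝔸), 0 < α₀ → M * α₀ ≤ a₀ →
      (bg (mem M i m)).Reg335 c35 α₀ (ιCfg M i m U₀ hU₀) →
      B9.Ineq342_346_347 (GA (mem M i m)) B₀ δ₀ (ιCfg M i m U₀ hU₀) ∧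
        B9.Ineq343_345 (GA (mem M i m)) Bβ Bε Bεβ δ₀ (ιCfg M i m U₀ hU₀)) :
    SockB9P3 (𝔸 := 𝔸) L (max 1 (2 * B₀ * max 1 q)) (2 * max 0 (CH * Bβ β) * max 1 q)
      (min (1 / 16) (min (c₆ / M) (min (a₀ / (K₆ * M)) (min (a₃ / (K₆ * M)) (1 / (2 * B₀ * c69 * M + 1))))))
      β len i.η m i.Ω i.Λs ΛbP := by
  intro α₀ α₂ hα₀ hα₀c hα₂ hα₂c U₀ W hU₀ hWu hInA _ hLanW A' _ h41 hA0
  -- the thresholds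
  have hη : 0 < i.η := i.hη
  have hLr : (1 : ℝ) ≤ L := by exact_mod_cast hL
  have hM0 : 0 < M := lt_of_lt_of_le one_pos hM1
  have hKM : 0 < K₆ * M := mul_pos hK₆ hM0
  simp only [le_min_iff] at hα₀c hα₂c
  obtain ⟨-, hα₀c6, hα₀a0, hα₀a3, hα₀θ⟩ := hα₀c
  obtain ⟨hα₂16, -, -, -, -⟩ := hα₂c
  have hc6 : M * α₀ ≤ c₆ := by rw [mul_comm]; exact (le_div_iff₀ hM0).1 hα₀c6
  have ha₉0 : 0 < K₆ * α₀ := mul_pos hK₆ hα₀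
  have ha0' : M * (K₆ * α₀) ≤ a₀ := by
    have h := (le_div_iff₀ hKM).1 hα₀a0
    calc M * (K₆ * α₀) = α₀ * (K₆ * M) := by ring
      _ ≤ a₀ := h
  have ha3' : M * (K₆ * α₀) ≤ a₃ := by
    have h := (le_div_iff₀ hKM).1 hα₀a3
    calc M * (K₆ * α₀) = α₀ * (K₆ * M) := by ring
      _ ≤ a₃ := h
  have hκ' : 0 ≤ c69 * M * α₀ := by positivity
  have hθ : B₀ * (c69 * M * α₀) ≤ 1 / 2 := by
    have hpos : 0 < 2 * B₀ * c69 * M + 1 := by positivity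
    have h1 : α₀ * (2 * B₀ * c69 * M + 1) ≤ 1 := (le_div_iff₀ hpos).1 hα₀θ
    linarith [hα₀.le]
  -- (3.35) for U₀ by Proposition 6, and Theorem 3.3's blocks for G(U₀)
  have hreg : (bg (mem M i m)).Reg335 c35 (K₆ * α₀) (ιCfg M i m U₀ hU₀) := hP6 α₀ U₀ hU₀ hα₀ hc6 hInA
  obtain ⟨h347, h345⟩ := h33U (K₆ * α₀) U₀ hU₀ ha₉0 ha0' hreg
  obtain ⟨-, hd⟩ := hdict
  -- A′ is a field of the class E(Ω₀) = E (every bond is a bond of Ω₀ = ℤᵈ)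
  have hU₀1 : ∀ x κ, U₀ x κ ∈ U1 𝔸 := fun x κ => unitaryUnits_le_U1 (hU₀ x κ)
  have hBT : ∀ (y : Site d) (τ : Fin d), BondTouches (i.Ω 0) y τ := fun y τ => Or.inl (by rw [hΩ]; exact Set.mem_univ y)
  have hAbd : Bdd L m i.η (-(1 : ℝ)) (fun j (b : Site d × Fin d) => SideTouches (i.Ω j) b.1 b.2) (fun b => A' b.1 b.2) := by
    have e1 : (-(1 : ℝ)) = -((1 : ℕ) : ℝ) := by norm_num
    rw [e1]
    refine B8ScaledSupNorm.bdd_of_forall (c := α₂) fun j hj b hb => ?_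
    rw [B8ScaledSupNorm.weight_neg_natCast, pow_one]
    have h := (h41 j hj b.1 b.2 hb).2
    have hs : 0 < (L : ℝ) ^ j * i.η := B8ScaledSupNorm.scale_pos hL hη j
    calc (L : ℝ) ^ j * i.η * ‖A' b.1 b.2‖ ≤ (L : ℝ) ^ j * i.η * (α₂ * ((L : ℝ) ^ j * i.η)⁻¹) :=
          mul_le_mul_of_nonneg_left h hs.le
      _ = α₂ := by rw [mul_comm α₂, ← mul_assoc, mul_inv_cancel₀ hs.ne', one_mul]
  have hOn : OnDom L m i.η i.Ω A' := ⟨fun y τ h => absurd (hBT y τ) h, hAbd⟩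
  obtain ⟨a, ha_def⟩ : ∃ a : ℝ,
      a = msup L m i.η (-(1 : ℝ)) (fun j (b : Site d × Fin d) => SideTouches (i.Ω j) b.1 b.2) (fun b => A' b.1 b.2) :=
    ⟨_, rfl⟩
  have ha0 : 0 ≤ a := by rw [ha_def]; exact B8ScaledSupNorm.msup_nonneg L m hη.le _ _ _
  -- the Landau condition for A′; the source J̃ = Δ_a(U₀)A′ and A′ = G(U₀)J̃ ((1.58))
  have hLanA : IsLandau138 L m i.η (i.Ω 0) (i.Λs m) U₀ A' := B9SupplySockB9P3Zd.landau_of_landauW hd2 hη U₀ hWu hα₂16 h41 hLanW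
  obtain ⟨Jt, hJt_def⟩ : ∃ Jt : Site d → Fin d → 𝔸, Jt = deltaAOf i.η (ops M i m) U₀ A' := ⟨_, rfl⟩
  have hGJ : (ops M i m).Gop U₀ Jt = A' :=
    hinv (K₆ * α₀) U₀ hU₀ ha₉0 ha3' hreg A' hOn Jt fun y τ _ => by rw [hJt_def]
  have hDRD : ∀ (x : Site d) (μ : Fin d), (ops M i m).DRDs U₀ A' x μ = 0 :=
    hlan (K₆ * α₀) U₀ hU₀ ha₉0 ha3' hreg A' hOn hLanA
  have hJtb : ∀ (x : Site d) (μ : Fin d),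
      Jt x μ = Jcur i.η U₀ A' μ x + (ops M i m).Dp U₀ A' x μ + (ops M i m).DRDs U₀ A' x μ + (ops M i m).QQ U₀ A' x μ := by
    intro x μ; rw [hJt_def]; rfl
  -- the right-hand side of the socket: |J|₍₋₃₎ and |B₁|
  obtain ⟨nJ, hnJ_def⟩ : ∃ nJ : ℝ, nJ = bondNorm L m i.η (-(3 : ℝ)) i.Ω (fun x μ => Jcur i.η U₀ A' μ x) := ⟨_, rfl⟩
  obtain ⟨nB, hnB_def⟩ : ∃ nB : ℝ, nB = wsup 1 (fun p : {p : ℕ × (Site d × Fin d) // p.1 ≤ m ∧ p.2 ∈ ΛbP m p.1} =>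
      linCovIter L U₀ (iEta i.η A') p.1.1 p.1.2.1 p.1.2.2) := ⟨_, rfl⟩
  have hnJ0 : 0 ≤ nJ := by rw [hnJ_def]; exact B8ScaledSupNorm.msup_nonneg L m hη.le _ _ _
  have hnB0 : 0 ≤ nB := by rw [hnB_def]; exact B8Eq155JBound.wsup_nonneg zero_le_one _
  -- J is bounded (A′ is)
  have hAglob : ∀ (y : Site d) (τ : Fin d), ‖A' y τ‖ ≤ α₂ * i.η⁻¹ := by
    intro y τ
    by_cases hmem : ∃ j, j ≤ m ∧ SideTouches (i.Ω j) y τ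
    · obtain ⟨j, hj, hs⟩ := hmem
      have hLj : (1 : ℝ) ≤ (L : ℝ) ^ j := one_le_pow₀ hLr
      calc ‖A' y τ‖ ≤ α₂ * ((L : ℝ) ^ j * i.η)⁻¹ := (h41 j hj y τ hs).2
        _ = α₂ * i.η⁻¹ * ((L : ℝ) ^ j)⁻¹ := by rw [mul_inv]; ring
        _ ≤ α₂ * i.η⁻¹ * 1 := by
            apply mul_le_mul_of_nonneg_left (inv_le_one_of_one_le₀ hLj) (by positivity)
        _ = α₂ * i.η⁻¹ := mul_one _
    · rw [hA0 y τ fun j hj hs => hmem ⟨j, hj, hs⟩, norm_zero]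
      positivity
  have hgrad : ∀ (y : Site d) (κ τ : Fin d), ‖covDerivFwd i.η U₀ κ (fun z => A' z τ) y‖ ≤ i.η⁻¹ * (α₂ * i.η⁻¹ + α₂ * i.η⁻¹) :=
    fun y κ τ => (B9SupplySockB9P3ZdLettersOmega.norm_covDerivFwd_le hη (hU₀1 _ _) _).trans
      (mul_le_mul_of_nonneg_left (add_le_add (hAglob _ _) (hAglob _ _)) (inv_nonneg.mpr hη.le))
  have hJbd : Bdd L m i.η (-(3 : ℝ)) (fun j (b : Site d × Fin d) => BondTouches (i.Ω j) b.1 b.2)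
      (fun b => Jcur i.η U₀ A' b.2 b.1) :=
    B9SupplySockB9P3Zd.bdd_neg_three_of_pointwise hL hη fun b => B9SupplySockB9P3Zd.norm_Jcur_le_of_grad hη hU₀1 hgrad b.2 b.1
  -- |J̃|₍₋₃₎ ≤ |J|₍₋₃₎ + c₆₉ M α₀ |A′|₍₋₁₎ + q |B₁| (pointwise: (3.26) with (3.69), the Landau condition, (3.16))
  have hJt : bondNorm L m i.η (-(3 : ℝ)) i.Ω Jt ≤ nJ + c69 * M * α₀ * a + q * nB := by
    have e3 : (-(3 : ℝ)) = -((3 : ℕ) : ℝ) := by norm_num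
    refine B8ScaledSupNorm.msup_le (by positivity) fun j hj b hb => ?_
    have hw : weight L i.η (-(3 : ℝ)) j = ((L : ℝ) ^ j * i.η) ^ 3 := by
      rw [e3, B8ScaledSupNorm.weight_neg_natCast]
    have hw0 : 0 ≤ ((L : ℝ) ^ j * i.η) ^ 3 := by positivity
    have h1 : weight L i.η (-(3 : ℝ)) j * ‖Jcur i.η U₀ A' b.2 b.1‖ ≤ nJ := by
      rw [hnJ_def]; exact B8ScaledSupNorm.weight_mul_norm_le_msup hJbd hj hb
    have h2 : ((L : ℝ) ^ j * i.η) ^ 3 * ‖(ops M i m).Dp U₀ A' b.1 b.2‖ ≤ c69 * M * α₀ * a := by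
      rw [ha_def]; exact hcurv α₀ U₀ hU₀ hα₀ hInA A' hOn j hj b.1 b.2 hb
    have h4 : ((L : ℝ) ^ j * i.η) ^ 3 * ‖(ops M i m).QQ U₀ A' b.1 b.2‖ ≤ q * nB := by
      rw [hnB_def]; exact havg U₀ hU₀ A' hOn j hj b.1 b.2 hb
    have hsum : ‖Jt b.1 b.2‖ ≤
        ‖Jcur i.η U₀ A' b.2 b.1‖ + ‖(ops M i m).Dp U₀ A' b.1 b.2‖ + ‖(ops M i m).QQ U₀ A' b.1 b.2‖ := by
      rw [hJtb, hDRD b.1 b.2, add_zero]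
      exact norm_add₃_le
    rw [hw] at h1 ⊢
    calc ((L : ℝ) ^ j * i.η) ^ 3 * ‖Jt b.1 b.2‖
        ≤ ((L : ℝ) ^ j * i.η) ^ 3 *
            (‖Jcur i.η U₀ A' b.2 b.1‖ + ‖(ops M i m).Dp U₀ A' b.1 b.2‖ + ‖(ops M i m).QQ U₀ A' b.1 b.2‖) :=
          mul_le_mul_of_nonneg_left hsum hw0
      _ = ((L : ℝ) ^ j * i.η) ^ 3 * ‖Jcur i.η U₀ A' b.2 b.1‖ + ((L : ℝ) ^ j * i.η) ^ 3 * ‖(ops M i m).Dp U₀ A' b.1 b.2‖ +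
            ((L : ℝ) ^ j * i.η) ^ 3 * ‖(ops M i m).QQ U₀ A' b.1 b.2‖ := by ring
      _ ≤ nJ + c69 * M * α₀ * a + q * nB := add_le_add (add_le_add h1 h2) h4
  -- Theorem 3.3's γ = −3 entries at J̃ through the dictionary ((3.47) ⇒ (1.59)), and the Hölder binder
  obtain ⟨hw, hG0, hG1, hG3⟩ := hd U₀ hU₀ Jt
  have hline1 : a ≤ B₀ * bondNorm L m i.η (-(3 : ℝ)) i.Ω Jt := by
    have h := B9.glob_at_minus_three (GA (mem M i m)) h347 0 (ιLoc M i m Jt)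
    rw [hG0, hw, hGJ, ← ha_def] at h
    exact h
  have hline2 : msup L m i.η (-(2 : ℝ)) (fun j (t : Fin d × Fin d × Site d) => SideTouches (i.Ω j) t.2.2 t.2.1)
      (fun t => covDerivFwd i.η U₀ t.1 (fun z => A' z t.2.1) t.2.2) ≤ B₀ * bondNorm L m i.η (-(3 : ℝ)) i.Ω Jt := by
    have h := B9.glob_at_minus_three (GA (mem M i m)) h347 1 (ιLoc M i m Jt)
    rw [hG1, hw, hGJ] at h
    exact h
  have hline4 : bondNorm L m i.η (-(3 : ℝ)) i.Ω (fun x μ => covLap i.η U₀ (fun z => A' z μ) x) ≤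
      B₀ * bondNorm L m i.η (-(3 : ℝ)) i.Ω Jt := by
    have h := B9.glob_at_minus_three (GA (mem M i m)) h347 3 (ιLoc M i m Jt)
    rw [hG3, hw, hGJ] at h
    exact h
  have hline5 : msup L m i.η (-(2 + β))
      (fun j (q : Fin d × Fin d × (Site d × Site d)) => q.2.2 ∈ AdmPair i.η len ∧ q.2.2.1 ∈ i.Ω j)
      (fun q => hquot i.η β len U₀ (covDerivFwd i.η U₀ q.1 (fun z => A' z q.2.1)) q.2.2) ≤
      max 0 (CH * Bβ β) * bondNorm L m i.η (-(3 : ℝ)) i.Ω Jt := by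
    have h := hhol Bβ Bε Bεβ δ₀ U₀ hU₀ h345 Jt
    rw [hGJ] at h
    exact h.trans (mul_le_mul_of_nonneg_right (le_max_right _ _) (B8ScaledSupNorm.msup_nonneg L m hη.le _ _ _))
  -- the a-priori (Neumann) step of G-IF-01, in the concrete norms
  have hJJ : bondNorm L m i.η (-(3 : ℝ)) i.Ω (fun x μ => pdiv i.η U₀ (plaqCovDeriv i.η U₀ A') μ x) = nJ := by
    rw [hnJ_def]; rfl
  rw [← ha_def, ← hnJ_def, ← hnB_def]
  exact B9SupplySockB9P3Zd.apriori_arith hB₀ hq hκ' hθ ha0 hnJ0 hnB0 (le_max_left 0 _) hJJ hJt hline1 hline2 hline4 hline5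

-- budget line (as the landed `sockSrc_core_at_univ'`: 300-line weighted-norm proof; elaborates well inside the default today)
set_option maxHeartbeats 400000 in
/-- ★ **(`CurvAtInAk` currency.)  THE SOURCED JUNCTION AT A MEMBER WITH `Ω₀ = ℤᵈ` ON THE GUARDED LETTER, AT ANY SUPPLIED DATUM CLASS `ΛbP`** —
`B9SupplySockB9P3ZdGammaUniv.sockSrc_core_at_univ_linP` with the Δ′ bound from `InAk`; `B9SupplySockB9P3ZdAtLin.sockSrc_core_at_univ_lin`
re-proved VERBATIM with the binder `AvgAtP … ΛbP` and `|B₁|` read over `ΛbP` in the five (1.59) lines (same constants B₀′ = max{1, 2B₀max{1,q}}, B₀β′ = 2C_βmax{1,q},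
C_β = max{0, C_H Bβ(β)}; B8 Theorem 8's frame (1.146)). [cite: Balaban1985RegularSpaces, Thm 8 + (1.146) p.101, (1.58)–(1.59) p.86, (1.31) p.82, Prop. 3 p.87, p.92; Balaban1985BackgroundPropagators, Thm 3.3 p.399, (3.20)–(3.27) pp.394–395, (3.43), (3.47) p.398, (3.69) p.404; Balaban1984PropagatorsII, (2.3) p.224] -/
theorem sockSrc_core_at_univ_linPI (hL : 1 ≤ L) {c35 c₆ K₆ a₃ c69 q CH β cS cSβ : ℝ} {len : Site d → ℝ}
    {M : ℝ} (hM1 : 1 ≤ M) (i : ZdIdx d L) (hΩ : i.Ω 0 = Set.univ) (m : ℕ)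
    (hdict : DictAt geo bg GA L mem ιCfg ιLoc ops M i m) (hP6 : Prop6At bg L mem ιCfg c35 c₆ K₆ M i m)
    (hinv : InvAt bg L mem ιCfg ops c35 a₃ M i m) (hcurv : CurvAtInAk L ops c69 M i m)
    (ΛbP : ℕ → ℕ → Set (Site d × Fin d)) (havg : AvgAtP L ops q ΛbP M i m)
    (hhol : HolderAt geo bg GA L mem ιCfg ops β len CH M i m) (hlin : LinBddAt L ops M i m)
    (hsrc : SrcAt bg L mem ιCfg ops c35 a₃ cS M i m) (hsrcH : SrcHolderAt bg L mem ιCfg ops c35 a₃ β len cSβ M i m)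
    (hK₆ : 0 < K₆) (hc69 : 0 ≤ c69) (hq : 0 ≤ q) (hcS : 0 ≤ cS) (hcSβ : 0 ≤ cSβ)
    {B₀ δ₀ a₀ : ℝ} {Bβ Bε : ℝ → ℝ} {Bεβ : ℝ → ℝ → ℝ} (hB₀ : 0 < B₀)
    (h33U : ∀ (α₀ : ℝ) (U₀ : Site d → Fin d → 𝔸ˣ) (hU₀ : ∀ x κ, U₀ x κ ∈ unitaryUnits 𝔸), 0 < α₀ → M * α₀ ≤ a₀ →
      (bg (mem M i m)).Reg335 c35 α₀ (ιCfg M i m U₀ hU₀) →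
      B9.Ineq342_346_347 (GA (mem M i m)) B₀ δ₀ (ιCfg M i m U₀ hU₀) ∧
        B9.Ineq343_345 (GA (mem M i m)) Bβ Bε Bεβ δ₀ (ιCfg M i m U₀ hU₀)) :
    ∀ α₀ α₂ : ℝ, 0 < α₀ →
      α₀ ≤ min (1 / 16) (min (c₆ / M) (min (a₀ / (K₆ * M)) (min (a₃ / (K₆ * M)) (1 / (2 * B₀ * c69 * M + 1))))) →
      0 < α₂ → α₂ ≤ 1 / 16 →
    ∀ (U₀ : Site d → Fin d → 𝔸ˣ), (∀ x κ, U₀ x κ ∈ unitaryUnits 𝔸) → InAk L m i.η α₀ i.Ω U₀ →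
    ∀ A' : Site d → Fin d → 𝔸,
    (∀ j, j ≤ m → ∀ (y : Site d) (τ : Fin d), SideTouches (i.Ω j) y τ → ‖A' y τ‖ ≤ α₂ * ((L : ℝ) ^ j * i.η)⁻¹) →
    (∀ (y : Site d) (τ : Fin d), (∀ j, j ≤ m → ¬ SideTouches (i.Ω j) y τ) → A' y τ = 0) →
    ∀ f : Site d → 𝔸, Bdd L i.k i.η (-(2 : ℝ)) (fun j (x : Site d) => x ∈ i.Ω j) f →
    (∃ μ : ℕ → Site d → 𝔸, ∀ x ∈ i.Ω 0, covLap i.η U₀ ((i.Ω 0).indicator (covDivB i.η U₀ A' - f)) x = QT L m (i.Λs m) U₀ μ x) →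
    msup L m i.η (-(1 : ℝ)) (fun j (b : Site d × Fin d) => SideTouches (i.Ω j) b.1 b.2) (fun b => A' b.1 b.2)
        ≤ max 1 (2 * B₀ * max 1 q) * (bondNorm L m i.η (-(3 : ℝ)) i.Ω (fun x μ => Jcur i.η U₀ A' μ x)
          + wsup 1 (fun p : {p : ℕ × (Site d × Fin d) // p.1 ≤ m ∧ p.2 ∈ ΛbP m p.1} =>
              linCovIter L U₀ (iEta i.η A') p.1.1 p.1.2.1 p.1.2.2))
          + 2 * (cS * msup L i.k i.η (-(2 : ℝ)) (fun j (x : Site d) => x ∈ i.Ω j) f) ∧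
      msup L m i.η (-(2 : ℝ)) (fun j (t : Fin d × Fin d × Site d) => SideTouches (i.Ω j) t.2.2 t.2.1)
          (fun t => covDerivFwd i.η U₀ t.1 (fun z => A' z t.2.1) t.2.2)
        ≤ max 1 (2 * B₀ * max 1 q) * (bondNorm L m i.η (-(3 : ℝ)) i.Ω (fun x μ => Jcur i.η U₀ A' μ x)
          + wsup 1 (fun p : {p : ℕ × (Site d × Fin d) // p.1 ≤ m ∧ p.2 ∈ ΛbP m p.1} =>
              linCovIter L U₀ (iEta i.η A') p.1.1 p.1.2.1 p.1.2.2))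
          + 2 * (cS * msup L i.k i.η (-(2 : ℝ)) (fun j (x : Site d) => x ∈ i.Ω j) f) ∧
      bondNorm L m i.η (-(3 : ℝ)) i.Ω (fun x μ => pdiv i.η U₀ (plaqCovDeriv i.η U₀ A') μ x)
        ≤ max 1 (2 * B₀ * max 1 q) * (bondNorm L m i.η (-(3 : ℝ)) i.Ω (fun x μ => Jcur i.η U₀ A' μ x)
          + wsup 1 (fun p : {p : ℕ × (Site d × Fin d) // p.1 ≤ m ∧ p.2 ∈ ΛbP m p.1} =>
              linCovIter L U₀ (iEta i.η A') p.1.1 p.1.2.1 p.1.2.2)) ∧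
      bondNorm L m i.η (-(3 : ℝ)) i.Ω (fun x μ => covLap i.η U₀ (fun z => A' z μ) x)
        ≤ max 1 (2 * B₀ * max 1 q) * (bondNorm L m i.η (-(3 : ℝ)) i.Ω (fun x μ => Jcur i.η U₀ A' μ x)
          + wsup 1 (fun p : {p : ℕ × (Site d × Fin d) // p.1 ≤ m ∧ p.2 ∈ ΛbP m p.1} =>
              linCovIter L U₀ (iEta i.η A') p.1.1 p.1.2.1 p.1.2.2))
          + 2 * (cS * msup L i.k i.η (-(2 : ℝ)) (fun j (x : Site d) => x ∈ i.Ω j) f) ∧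
      msup L m i.η (-(2 + β)) (fun j (q : Fin d × Fin d × (Site d × Site d)) => q.2.2 ∈ AdmPair i.η len ∧ q.2.2.1 ∈ i.Ω j)
          (fun q => hquot i.η β len U₀ (covDerivFwd i.η U₀ q.1 (fun z => A' z q.2.1)) q.2.2)
        ≤ 2 * max 0 (CH * Bβ β) * max 1 q * (bondNorm L m i.η (-(3 : ℝ)) i.Ω (fun x μ => Jcur i.η U₀ A' μ x)
          + wsup 1 (fun p : {p : ℕ × (Site d × Fin d) // p.1 ≤ m ∧ p.2 ∈ ΛbP m p.1} =>
              linCovIter L U₀ (iEta i.η A') p.1.1 p.1.2.1 p.1.2.2))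
          + (max 0 (CH * Bβ β) * (cS * msup L i.k i.η (-(2 : ℝ)) (fun j (x : Site d) => x ∈ i.Ω j) f) / B₀
            + cSβ * msup L i.k i.η (-(2 : ℝ)) (fun j (x : Site d) => x ∈ i.Ω j) f) := by
  intro α₀ α₂ hα₀ hα₀c hα₂ hα₂16 U₀ hU₀ hInA A' h41 hA0 f hfB hcl
  -- the thresholds
  have hη : 0 < i.η := i.hη
  have hLr : (1 : ℝ) ≤ L := by exact_mod_cast hL
  have hM0 : 0 < M := lt_of_lt_of_le one_pos hM1
  have hKM : 0 < K₆ * M := mul_pos hK₆ hM0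
  simp only [le_min_iff] at hα₀c
  obtain ⟨-, hα₀c6, hα₀a0, hα₀a3, hα₀θ⟩ := hα₀c
  have hc6 : M * α₀ ≤ c₆ := by rw [mul_comm]; exact (le_div_iff₀ hM0).1 hα₀c6
  have ha₉0 : 0 < K₆ * α₀ := mul_pos hK₆ hα₀
  have ha0' : M * (K₆ * α₀) ≤ a₀ := by
    have h := (le_div_iff₀ hKM).1 hα₀a0
    calc M * (K₆ * α₀) = α₀ * (K₆ * M) := by ring
      _ ≤ a₀ := h
  have ha3' : M * (K₆ * α₀) ≤ a₃ := by
    have h := (le_div_iff₀ hKM).1 hα₀a3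
    calc M * (K₆ * α₀) = α₀ * (K₆ * M) := by ring
      _ ≤ a₃ := h
  have hκ' : 0 ≤ c69 * M * α₀ := by positivity
  have hθ : B₀ * (c69 * M * α₀) ≤ 1 / 2 := by
    have hpos : 0 < 2 * B₀ * c69 * M + 1 := by positivity
    have h1 : α₀ * (2 * B₀ * c69 * M + 1) ≤ 1 := (le_div_iff₀ hpos).1 hα₀θ
    linarith [hα₀.le]
  -- (3.35) for U₀ by Proposition 6, and Theorem 3.3's blocks for G(U₀)
  have hreg : (bg (mem M i m)).Reg335 c35 (K₆ * α₀) (ιCfg M i m U₀ hU₀) := hP6 α₀ U₀ hU₀ hα₀ hc6 hInA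
  obtain ⟨h347, h345⟩ := h33U (K₆ * α₀) U₀ hU₀ ha₉0 ha0' hreg
  obtain ⟨-, hd⟩ := hdict
  -- A′ ∈ E(Ω₀) (every bond is a bond of Ω₀ = ℤᵈ); A′ uniformly bounded
  have hU₀1 : ∀ x κ, U₀ x κ ∈ U1 𝔸 := fun x κ => unitaryUnits_le_U1 (hU₀ x κ)
  have hBT : ∀ (y : Site d) (τ : Fin d), BondTouches (i.Ω 0) y τ := fun y τ => Or.inl (by rw [hΩ]; exact Set.mem_univ y)
  have hAbd : Bdd L m i.η (-(1 : ℝ)) (fun j (b : Site d × Fin d) => SideTouches (i.Ω j) b.1 b.2) (fun b => A' b.1 b.2) := by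
    have e1 : (-(1 : ℝ)) = -((1 : ℕ) : ℝ) := by norm_num
    rw [e1]
    refine B8ScaledSupNorm.bdd_of_forall (c := α₂) fun j hj b hb => ?_
    rw [B8ScaledSupNorm.weight_neg_natCast, pow_one]
    have h := h41 j hj b.1 b.2 hb
    have hs : 0 < (L : ℝ) ^ j * i.η := B8ScaledSupNorm.scale_pos hL hη j
    calc (L : ℝ) ^ j * i.η * ‖A' b.1 b.2‖ ≤ (L : ℝ) ^ j * i.η * (α₂ * ((L : ℝ) ^ j * i.η)⁻¹) :=
          mul_le_mul_of_nonneg_left h hs.le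
      _ = α₂ := by rw [mul_comm α₂, ← mul_assoc, mul_inv_cancel₀ hs.ne', one_mul]
  have hOn : OnDom L m i.η i.Ω A' := ⟨fun y τ h => absurd (hBT y τ) h, hAbd⟩
  have hAglob : ∀ (y : Site d) (τ : Fin d), ‖A' y τ‖ ≤ α₂ * i.η⁻¹ := by
    intro y τ
    by_cases hmem : ∃ j, j ≤ m ∧ SideTouches (i.Ω j) y τ
    · obtain ⟨j, hj, hs⟩ := hmem
      have hLj : (1 : ℝ) ≤ (L : ℝ) ^ j := one_le_pow₀ hLr
      calc ‖A' y τ‖ ≤ α₂ * ((L : ℝ) ^ j * i.η)⁻¹ := h41 j hj y τ hs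
        _ = α₂ * i.η⁻¹ * ((L : ℝ) ^ j)⁻¹ := by rw [mul_inv]; ring
        _ ≤ α₂ * i.η⁻¹ * 1 := by
            apply mul_le_mul_of_nonneg_left (inv_le_one_of_one_le₀ hLj) (by positivity)
        _ = α₂ * i.η⁻¹ := mul_one _
    · rw [hA0 y τ fun j hj hs => hmem ⟨j, hj, hs⟩, norm_zero]
      positivity
  obtain ⟨a, ha_def⟩ : ∃ a : ℝ,
      a = msup L m i.η (-(1 : ℝ)) (fun j (b : Site d × Fin d) => SideTouches (i.Ω j) b.1 b.2) (fun b => A' b.1 b.2) := ⟨_, rfl⟩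
  have ha0 : 0 ≤ a := by rw [ha_def]; exact B8ScaledSupNorm.msup_nonneg L m hη.le _ _ _
  -- the sources: J̃₁ = J + Δ′A′ + Q*aQA′ and the (1.146) term S = DRD*A′; Δ_aA′ = J̃₁ + S; (1.58) + additivity
  obtain ⟨Jt, hJt_def⟩ : ∃ Jt : Site d → Fin d → 𝔸,
      Jt = fun x μ => Jcur i.η U₀ A' μ x + (ops M i m).Dp U₀ A' x μ + (ops M i m).QQ U₀ A' x μ := ⟨_, rfl⟩
  obtain ⟨S, hS_def⟩ : ∃ S : Site d → Fin d → 𝔸, S = fun x μ => (ops M i m).DRDs U₀ A' x μ := ⟨_, rfl⟩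
  have hGJS : (ops M i m).Gop U₀ (Jt + S) = A' := by
    refine hinv (K₆ * α₀) U₀ hU₀ ha₉0 ha3' hreg A' hOn (Jt + S) fun y τ _ => ?_
    rw [hJt_def, hS_def]
    simp only [Pi.add_apply, deltaAOf]
    abel
  obtain ⟨GS, hGS_def⟩ : ∃ GS : Site d → Fin d → 𝔸, GS = (ops M i m).Gop U₀ S := ⟨_, rfl⟩
  -- the guarded letter's boundedness side conditions: A′ is sup-bounded, hence so is S = DRD*A′ (clause 2)
  have hA'B : BddF A' := ⟨α₂ * i.η⁻¹, hAglob⟩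
  have hSB : BddF S := by rw [hS_def]; exact hlin.2 U₀ hU₀ A' hA'B
  -- the source binder at (A′, f)
  obtain ⟨⟨C, hC⟩, hS1, hS2, hS4⟩ := hsrc (K₆ * α₀) U₀ hU₀ ha₉0 ha3' hreg A' hOn f hfB hcl
  obtain ⟨hSbdd, hS5⟩ := hsrcH (K₆ * α₀) U₀ hU₀ ha₉0 ha3' hreg A' hOn f hfB hcl
  rw [← hS_def, ← hGS_def] at hC hS1 hS2 hS4 hSbdd hS5
  obtain ⟨F, hF_def⟩ : ∃ F : ℝ, F = msup L i.k i.η (-(2 : ℝ)) (fun j (x : Site d) => x ∈ i.Ω j) f := ⟨_, rfl⟩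
  have hF0 : 0 ≤ F := by rw [hF_def]; exact B8ScaledSupNorm.msup_nonneg L i.k hη.le _ _ _
  rw [← hF_def] at hS1 hS2 hS4 hS5
  -- the right-hand side quantities: |J|₍₋₃₎ and |B₁|
  obtain ⟨nJ, hnJ_def⟩ : ∃ nJ : ℝ, nJ = bondNorm L m i.η (-(3 : ℝ)) i.Ω (fun x μ => Jcur i.η U₀ A' μ x) := ⟨_, rfl⟩
  obtain ⟨nB, hnB_def⟩ : ∃ nB : ℝ, nB = wsup 1 (fun p : {p : ℕ × (Site d × Fin d) // p.1 ≤ m ∧ p.2 ∈ ΛbP m p.1} =>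
      linCovIter L U₀ (iEta i.η A') p.1.1 p.1.2.1 p.1.2.2) := ⟨_, rfl⟩
  have hnJ0 : 0 ≤ nJ := by rw [hnJ_def]; exact B8ScaledSupNorm.msup_nonneg L m hη.le _ _ _
  have hnB0 : 0 ≤ nB := by rw [hnB_def]; exact B8Eq155JBound.wsup_nonneg zero_le_one _
  -- J is bounded (A′ is)
  have hgrad : ∀ (y : Site d) (κ τ : Fin d), ‖covDerivFwd i.η U₀ κ (fun z => A' z τ) y‖ ≤ i.η⁻¹ * (α₂ * i.η⁻¹ + α₂ * i.η⁻¹) :=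
    fun y κ τ => (B9SupplySockB9P3ZdLettersOmega.norm_covDerivFwd_le hη (hU₀1 _ _) _).trans
      (mul_le_mul_of_nonneg_left (add_le_add (hAglob _ _) (hAglob _ _)) (inv_nonneg.mpr hη.le))
  have hJbd : Bdd L m i.η (-(3 : ℝ)) (fun j (b : Site d × Fin d) => BondTouches (i.Ω j) b.1 b.2)
      (fun b => Jcur i.η U₀ A' b.2 b.1) :=
    B9SupplySockB9P3Zd.bdd_neg_three_of_pointwise hL hη fun b => B9SupplySockB9P3Zd.norm_Jcur_le_of_grad hη hU₀1 hgrad b.2 b.1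
  -- |J̃₁|₍₋₃₎ ≤ |J|₍₋₃₎ + c₆₉ M α₀ |A′|₍₋₁₎ + q |B₁| ((3.69), (3.16))
  have hJt : bondNorm L m i.η (-(3 : ℝ)) i.Ω Jt ≤ nJ + c69 * M * α₀ * a + q * nB := by
    have e3 : (-(3 : ℝ)) = -((3 : ℕ) : ℝ) := by norm_num
    refine B8ScaledSupNorm.msup_le (by positivity) fun j hj b hb => ?_
    have hw : weight L i.η (-(3 : ℝ)) j = ((L : ℝ) ^ j * i.η) ^ 3 := by
      rw [e3, B8ScaledSupNorm.weight_neg_natCast]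
    have hw0 : 0 ≤ ((L : ℝ) ^ j * i.η) ^ 3 := by positivity
    have h1 : weight L i.η (-(3 : ℝ)) j * ‖Jcur i.η U₀ A' b.2 b.1‖ ≤ nJ := by
      rw [hnJ_def]; exact B8ScaledSupNorm.weight_mul_norm_le_msup hJbd hj hb
    have h2 : ((L : ℝ) ^ j * i.η) ^ 3 * ‖(ops M i m).Dp U₀ A' b.1 b.2‖ ≤ c69 * M * α₀ * a := by
      rw [ha_def]; exact hcurv α₀ U₀ hU₀ hα₀ hInA A' hOn j hj b.1 b.2 hb
    have h4 : ((L : ℝ) ^ j * i.η) ^ 3 * ‖(ops M i m).QQ U₀ A' b.1 b.2‖ ≤ q * nB := by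
      rw [hnB_def]; exact havg U₀ hU₀ A' hOn j hj b.1 b.2 hb
    have hsum : ‖Jt b.1 b.2‖ ≤
        ‖Jcur i.η U₀ A' b.2 b.1‖ + ‖(ops M i m).Dp U₀ A' b.1 b.2‖ + ‖(ops M i m).QQ U₀ A' b.1 b.2‖ := by
      rw [hJt_def]
      exact norm_add₃_le
    rw [hw] at h1 ⊢
    calc ((L : ℝ) ^ j * i.η) ^ 3 * ‖Jt b.1 b.2‖
        ≤ ((L : ℝ) ^ j * i.η) ^ 3 *
            (‖Jcur i.η U₀ A' b.2 b.1‖ + ‖(ops M i m).Dp U₀ A' b.1 b.2‖ + ‖(ops M i m).QQ U₀ A' b.1 b.2‖) :=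
          mul_le_mul_of_nonneg_left hsum hw0
      _ = ((L : ℝ) ^ j * i.η) ^ 3 * ‖Jcur i.η U₀ A' b.2 b.1‖ + ((L : ℝ) ^ j * i.η) ^ 3 * ‖(ops M i m).Dp U₀ A' b.1 b.2‖ +
            ((L : ℝ) ^ j * i.η) ^ 3 * ‖(ops M i m).QQ U₀ A' b.1 b.2‖ := by ring
      _ ≤ nJ + c69 * M * α₀ * a + q * nB := add_le_add (add_le_add h1 h2) h4
  -- J̃₁ is sup-bounded (the same pointwise bounds at level 0: every bond is a bond of Ω₀ = ℤᵈ); (1.58) + the GUARDED additivity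
  have hJtB : BddF Jt := by
    refine ⟨(i.η ^ 3)⁻¹ * (nJ + c69 * M * α₀ * a + q * nB), fun y τ => ?_⟩
    have hb : BondTouches (i.Ω 0) y τ := hBT y τ
    have e3 : (-(3 : ℝ)) = -((3 : ℕ) : ℝ) := by norm_num
    have hw : weight L i.η (-(3 : ℝ)) 0 = i.η ^ 3 := by
      rw [e3, B8ScaledSupNorm.weight_neg_natCast, pow_zero, one_mul]
    have hη3 : 0 < i.η ^ 3 := pow_pos hη 3
    have h1 : i.η ^ 3 * ‖Jcur i.η U₀ A' τ y‖ ≤ nJ := by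
      rw [hnJ_def, ← hw]; exact B8ScaledSupNorm.weight_mul_norm_le_msup hJbd (Nat.zero_le m) (i := (y, τ)) hb
    have h2 : i.η ^ 3 * ‖(ops M i m).Dp U₀ A' y τ‖ ≤ c69 * M * α₀ * a := by
      have h := hcurv α₀ U₀ hU₀ hα₀ hInA A' hOn 0 (Nat.zero_le m) y τ hb
      rw [pow_zero, one_mul] at h
      rw [ha_def]; exact h
    have h4 : i.η ^ 3 * ‖(ops M i m).QQ U₀ A' y τ‖ ≤ q * nB := by
      have h := havg U₀ hU₀ A' hOn 0 (Nat.zero_le m) y τ hb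
      rw [pow_zero, one_mul] at h
      rw [hnB_def]; exact h
    have hsum : ‖Jt y τ‖ ≤ ‖Jcur i.η U₀ A' τ y‖ + ‖(ops M i m).Dp U₀ A' y τ‖ + ‖(ops M i m).QQ U₀ A' y τ‖ := by
      rw [hJt_def]; exact norm_add₃_le
    rw [le_inv_mul_iff₀ hη3]
    calc i.η ^ 3 * ‖Jt y τ‖ ≤ i.η ^ 3 * (‖Jcur i.η U₀ A' τ y‖ + ‖(ops M i m).Dp U₀ A' y τ‖ + ‖(ops M i m).QQ U₀ A' y τ‖) :=
          mul_le_mul_of_nonneg_left hsum hη3.le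
      _ ≤ nJ + c69 * M * α₀ * a + q * nB := by rw [mul_add, mul_add]; exact add_le_add (add_le_add h1 h2) h4
  have hGJ : (ops M i m).Gop U₀ Jt = A' - GS := by
    rw [hGS_def, eq_sub_iff_add_eq, ← hlin.1 U₀ hU₀ Jt S hJtB hSB, hGJS]
  -- Theorem 3.3's γ = −3 entries at J̃₁ through the dictionary: the lines of A′ − GS
  obtain ⟨N, hN_def⟩ : ∃ N : ℝ, N = bondNorm L m i.η (-(3 : ℝ)) i.Ω Jt := ⟨_, rfl⟩
  rw [← hN_def] at hJt
  obtain ⟨hw, hG0, hG1, hG3⟩ := hd U₀ hU₀ Jt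
  have hD1 : msup L m i.η (-(1 : ℝ)) (fun j (b : Site d × Fin d) => SideTouches (i.Ω j) b.1 b.2) (fun b => (A' - GS) b.1 b.2) ≤ B₀ * N := by
    have h := B9.glob_at_minus_three (GA (mem M i m)) h347 0 (ιLoc M i m Jt)
    rw [hG0, hw, hGJ, ← hN_def] at h
    exact h
  have hD2 : msup L m i.η (-(2 : ℝ)) (fun j (t : Fin d × Fin d × Site d) => SideTouches (i.Ω j) t.2.2 t.2.1)
      (fun t => covDerivFwd i.η U₀ t.1 (fun z => (A' - GS) z t.2.1) t.2.2) ≤ B₀ * N := by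
    have h := B9.glob_at_minus_three (GA (mem M i m)) h347 1 (ιLoc M i m Jt)
    rw [hG1, hw, hGJ, ← hN_def] at h
    exact h
  have hD4 : bondNorm L m i.η (-(3 : ℝ)) i.Ω (fun x μ => covLap i.η U₀ (fun z => (A' - GS) z μ) x) ≤ B₀ * N := by
    have h := B9.glob_at_minus_three (GA (mem M i m)) h347 3 (ιLoc M i m Jt)
    rw [hG3, hw, hGJ, ← hN_def] at h
    exact h
  have hD5 : msup L m i.η (-(2 + β))
      (fun j (q : Fin d × Fin d × (Site d × Site d)) => q.2.2 ∈ AdmPair i.η len ∧ q.2.2.1 ∈ i.Ω j)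
      (fun q => hquot i.η β len U₀ (covDerivFwd i.η U₀ q.1 (fun z => (A' - GS) z q.2.1)) q.2.2) ≤ max 0 (CH * Bβ β) * N := by
    have h := hhol Bβ Bε Bεβ δ₀ U₀ hU₀ h345 Jt
    rw [hGJ, ← hN_def] at h
    exact h.trans (mul_le_mul_of_nonneg_right (le_max_right _ _) (by rw [hN_def]; exact B8ScaledSupNorm.msup_nonneg L m hη.le _ _ _))
  -- splitting A′ = (A′ − GS) + GS in the four local norms (bounded families) and in the Hölder functional (junk-aware)
  have hsplit : ∀ (y : Site d) (τ : Fin d), A' y τ = (A' - GS) y τ + GS y τ := fun y τ => by simp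
  have hGSglob : ∀ (y : Site d) (τ : Fin d), ‖GS y τ‖ ≤ C := hC
  have hAGglob : ∀ (y : Site d) (τ : Fin d), ‖(A' - GS) y τ‖ ≤ α₂ * i.η⁻¹ + C := fun y τ => by
    rw [Pi.sub_apply, Pi.sub_apply]
    exact (norm_sub_le _ _).trans (add_le_add (hAglob y τ) (hC y τ))
  have e1 : (-(1 : ℝ)) = -((1 : ℕ) : ℝ) := by norm_num
  have e2 : (-(2 : ℝ)) = -((2 : ℕ) : ℝ) := by norm_num
  have e3 : (-(3 : ℝ)) = -((3 : ℕ) : ℝ) := by norm_num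
  have hL1 : a ≤ B₀ * N + cS * F := by
    rw [ha_def]
    refine (msup_le_add_of_norm_le hη.le (F := fun b : Site d × Fin d => (A' - GS) b.1 b.2) (G := fun b : Site d × Fin d => GS b.1 b.2)
      (fun b => by rw [hsplit]; exact norm_add_le _ _) ?_ ?_).trans (add_le_add hD1 hS1)
    · rw [e1]; exact B9SupplySockB9P3ZdLettersOmega.bdd_neg_of_pointwise hL hη 1 fun b => hAGglob b.1 b.2
    · rw [e1]; exact B9SupplySockB9P3ZdLettersOmega.bdd_neg_of_pointwise hL hη 1 fun b => hGSglob b.1 b.2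
  have hL2 : msup L m i.η (-(2 : ℝ)) (fun j (t : Fin d × Fin d × Site d) => SideTouches (i.Ω j) t.2.2 t.2.1)
      (fun t => covDerivFwd i.η U₀ t.1 (fun z => A' z t.2.1) t.2.2) ≤ B₀ * N + cS * F := by
    refine (msup_le_add_of_norm_le hη.le
      (F := fun t : Fin d × Fin d × Site d => covDerivFwd i.η U₀ t.1 (fun z => (A' - GS) z t.2.1) t.2.2)
      (G := fun t : Fin d × Fin d × Site d => covDerivFwd i.η U₀ t.1 (fun z => GS z t.2.1) t.2.2)
      (fun t => ?_) ?_ ?_).trans (add_le_add hD2 hS2)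
    · have h : (fun z => A' z t.2.1) = (fun z => (A' - GS) z t.2.1) + fun z => GS z t.2.1 := by
        funext z; simp
      rw [h, B8LambdaSpaceKLevel.covDerivFwd_add']
      exact norm_add_le _ _
    · rw [e2]
      refine B9SupplySockB9P3ZdLettersOmega.bdd_neg_of_pointwise hL hη 2 (c := i.η⁻¹ * ((α₂ * i.η⁻¹ + C) + (α₂ * i.η⁻¹ + C))) fun t => ?_
      exact (B9SupplySockB9P3ZdLettersOmega.norm_covDerivFwd_le hη (hU₀1 _ _) _).trans
        (mul_le_mul_of_nonneg_left (add_le_add (hAGglob _ _) (hAGglob _ _)) (inv_nonneg.mpr hη.le))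
    · rw [e2]
      refine B9SupplySockB9P3ZdLettersOmega.bdd_neg_of_pointwise hL hη 2 (c := i.η⁻¹ * (C + C)) fun t => ?_
      exact (B9SupplySockB9P3ZdLettersOmega.norm_covDerivFwd_le hη (hU₀1 _ _) _).trans
        (mul_le_mul_of_nonneg_left (add_le_add (hGSglob _ _) (hGSglob _ _)) (inv_nonneg.mpr hη.le))
  have hL4 : bondNorm L m i.η (-(3 : ℝ)) i.Ω (fun x μ => covLap i.η U₀ (fun z => A' z μ) x) ≤ B₀ * N + cS * F := by
    unfold bondNorm at hD4 hS4 ⊢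
    refine (msup_le_add_of_norm_le hη.le
      (F := fun b : Site d × Fin d => covLap i.η U₀ (fun z => (A' - GS) z b.2) b.1)
      (G := fun b : Site d × Fin d => covLap i.η U₀ (fun z => GS z b.2) b.1)
      (fun b => ?_) ?_ ?_).trans (add_le_add hD4 hS4)
    · dsimp only
      have h : (fun z => A' z b.2) = (fun z => (A' - GS) z b.2) + fun z => GS z b.2 := by
        funext z; simp
      rw [h, B9SupplySockB9P3ZdLettersOmega.covLap_add]
      exact norm_add_le _ _
    · rw [e3]
      exact B9SupplySockB9P3ZdLettersOmega.bdd_neg_of_pointwise hL hη 3 fun b =>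
        B9SupplySockB9P3ZdLettersOmega.norm_covLap_le hη hU₀1 (fun y => hAGglob y b.2) b.1
    · rw [e3]
      exact B9SupplySockB9P3ZdLettersOmega.bdd_neg_of_pointwise hL hη 3 fun b =>
        B9SupplySockB9P3ZdLettersOmega.norm_covLap_le hη hU₀1 (fun y => hGSglob y b.2) b.1
  have hCβ0 : 0 ≤ max 0 (CH * Bβ β) := le_max_left _ _
  have hN0 : 0 ≤ N := by rw [hN_def]; exact B8ScaledSupNorm.msup_nonneg L m hη.le _ _ _
  have hL5 : msup L m i.η (-(2 + β))
      (fun j (q : Fin d × Fin d × (Site d × Site d)) => q.2.2 ∈ AdmPair i.η len ∧ q.2.2.1 ∈ i.Ω j)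
      (fun q => hquot i.η β len U₀ (covDerivFwd i.η U₀ q.1 (fun z => A' z q.2.1)) q.2.2) ≤ max 0 (CH * Bβ β) * N + cSβ * F := by
    by_cases hB : Bdd L m i.η (-(2 + β))
        (fun j (q : Fin d × Fin d × (Site d × Site d)) => q.2.2 ∈ AdmPair i.η len ∧ q.2.2.1 ∈ i.Ω j)
        (fun q => hquot i.η β len U₀ (covDerivFwd i.η U₀ q.1 (fun z => A' z q.2.1)) q.2.2)
    · -- bounded: the family of A′ − GS is bounded too, and the norm splits
      have hcd : ∀ q : Fin d × Fin d × (Site d × Site d),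
          covDerivFwd i.η U₀ q.1 (fun z => (A' - GS) z q.2.1) =
            covDerivFwd i.η U₀ q.1 (fun z => A' z q.2.1) - covDerivFwd i.η U₀ q.1 (fun z => GS z q.2.1) := by
        intro q
        funext x
        have h : (fun z => A' z q.2.1) = (fun z => (A' - GS) z q.2.1) + fun z => GS z q.2.1 := by
          funext z; simp
        rw [Pi.sub_apply, h, B8LambdaSpaceKLevel.covDerivFwd_add']
        abel
      have hcd' : ∀ q : Fin d × Fin d × (Site d × Site d),
          covDerivFwd i.η U₀ q.1 (fun z => A' z q.2.1) =
            covDerivFwd i.η U₀ q.1 (fun z => (A' - GS) z q.2.1) + covDerivFwd i.η U₀ q.1 (fun z => GS z q.2.1) := by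
        intro q; rw [hcd]; abel
      have hBdiff : Bdd L m i.η (-(2 + β))
          (fun j (q : Fin d × Fin d × (Site d × Site d)) => q.2.2 ∈ AdmPair i.η len ∧ q.2.2.1 ∈ i.Ω j)
          (fun q => hquot i.η β len U₀ (covDerivFwd i.η U₀ q.1 (fun z => (A' - GS) z q.2.1)) q.2.2) := by
        obtain ⟨c₁, hc₁⟩ := hB
        obtain ⟨c₂, hc₂⟩ := hSbdd
        refine ⟨c₁ + c₂, fun j hj q hq => ?_⟩
        have hw0 : 0 ≤ weight L i.η (-(2 + β)) j := B8ScaledSupNorm.weight_nonneg L hη.le _ j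
        have hle : hquot i.η β len U₀ (covDerivFwd i.η U₀ q.1 (fun z => (A' - GS) z q.2.1)) q.2.2 ≤
            hquot i.η β len U₀ (covDerivFwd i.η U₀ q.1 (fun z => A' z q.2.1)) q.2.2 +
              hquot i.η β len U₀ (covDerivFwd i.η U₀ q.1 (fun z => GS z q.2.1)) q.2.2 := by
          rw [hcd]; exact hquot_sub_le hη.le β U₀ _ _ hq.1
        have hn : ∀ r : ℝ, 0 ≤ r → ‖r‖ = r := fun r hr => Real.norm_of_nonneg hr
        have hq1 := B9Eq340HolderZd.hquot_nonneg hη.le β U₀ (covDerivFwd i.η U₀ q.1 (fun z => (A' - GS) z q.2.1)) hq.1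
        have hq2 := B9Eq340HolderZd.hquot_nonneg hη.le β U₀ (covDerivFwd i.η U₀ q.1 (fun z => A' z q.2.1)) hq.1
        have hq3 := B9Eq340HolderZd.hquot_nonneg hη.le β U₀ (covDerivFwd i.η U₀ q.1 (fun z => GS z q.2.1)) hq.1
        have h₁ := hc₁ j hj q hq
        have h₂ := hc₂ j hj q hq
        rw [hn _ hq2] at h₁
        rw [hn _ hq3] at h₂
        rw [hn _ hq1]
        calc weight L i.η (-(2 + β)) j * hquot i.η β len U₀ (covDerivFwd i.η U₀ q.1 (fun z => (A' - GS) z q.2.1)) q.2.2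
            ≤ weight L i.η (-(2 + β)) j * (hquot i.η β len U₀ (covDerivFwd i.η U₀ q.1 (fun z => A' z q.2.1)) q.2.2 +
              hquot i.η β len U₀ (covDerivFwd i.η U₀ q.1 (fun z => GS z q.2.1)) q.2.2) := mul_le_mul_of_nonneg_left hle hw0
          _ ≤ c₁ + c₂ := by rw [mul_add]; exact add_le_add h₁ h₂
      refine (msup_le_add_of_norm_le hη.le
        (F := fun q : Fin d × Fin d × (Site d × Site d) => hquot i.η β len U₀ (covDerivFwd i.η U₀ q.1 (fun z => (A' - GS) z q.2.1)) q.2.2)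
        (G := fun q : Fin d × Fin d × (Site d × Site d) => hquot i.η β len U₀ (covDerivFwd i.η U₀ q.1 (fun z => GS z q.2.1)) q.2.2)
        (fun q => ?_) hBdiff hSbdd).trans (add_le_add hD5 hS5)
      -- pointwise: on non-admissible pairs both sides may be junk, but the norm splitting only needs `‖x‖ ≤ ‖y‖ + ‖z‖`
      by_cases hq : q.2.2 ∈ AdmPair i.η len
      · have hq1 := B9Eq340HolderZd.hquot_nonneg hη.le β U₀ (covDerivFwd i.η U₀ q.1 (fun z => (A' - GS) z q.2.1)) hq
        have hq2 := B9Eq340HolderZd.hquot_nonneg hη.le β U₀ (covDerivFwd i.η U₀ q.1 (fun z => A' z q.2.1)) hq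
        have hq3 := B9Eq340HolderZd.hquot_nonneg hη.le β U₀ (covDerivFwd i.η U₀ q.1 (fun z => GS z q.2.1)) hq
        rw [Real.norm_of_nonneg hq1, Real.norm_of_nonneg hq2, Real.norm_of_nonneg hq3, hcd']
        exact hquot_add_le hη.le β U₀ _ _ hq
      · -- off the admissible pairs the quotient's denominator is the same on both sides: split the numerator
        simp only [B9Eq340HolderZd.hquot_def, hcd', Real.norm_eq_abs, abs_div]
        rw [← add_div]
        by_cases hden : |(i.η * len (q.2.2.2 - q.2.2.1)) ^ β| = 0
        · simp [hden]
        · refine div_le_div_of_nonneg_right ?_ (lt_of_le_of_ne (abs_nonneg _) (Ne.symm hden)).le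
          rw [abs_of_nonneg (norm_nonneg _), abs_of_nonneg (norm_nonneg _), abs_of_nonneg (norm_nonneg _), Pi.add_apply, trans_add]
          calc ‖trans U₀ q.2.2.1 q.2.2.2 (covDerivFwd i.η U₀ q.1 (fun z => (A' - GS) z q.2.1) q.2.2.2) +
                  trans U₀ q.2.2.1 q.2.2.2 (covDerivFwd i.η U₀ q.1 (fun z => GS z q.2.1) q.2.2.2) -
                (covDerivFwd i.η U₀ q.1 (fun z => (A' - GS) z q.2.1) q.2.2.1 + covDerivFwd i.η U₀ q.1 (fun z => GS z q.2.1) q.2.2.1)‖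
              = ‖(trans U₀ q.2.2.1 q.2.2.2 (covDerivFwd i.η U₀ q.1 (fun z => (A' - GS) z q.2.1) q.2.2.2) -
                    covDerivFwd i.η U₀ q.1 (fun z => (A' - GS) z q.2.1) q.2.2.1) +
                  (trans U₀ q.2.2.1 q.2.2.2 (covDerivFwd i.η U₀ q.1 (fun z => GS z q.2.1) q.2.2.2) -
                    covDerivFwd i.η U₀ q.1 (fun z => GS z q.2.1) q.2.2.1)‖ := by congr 1; abel
            _ ≤ _ := norm_add_le _ _
    · rw [msup_eq_zero_of_not_bdd hB]
      positivity
  -- the a-priori (Neumann) step with the additive source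
  have hJJ : bondNorm L m i.η (-(3 : ℝ)) i.Ω (fun x μ => pdiv i.η U₀ (plaqCovDeriv i.η U₀ A') μ x) = nJ := by
    rw [hnJ_def]; rfl
  have hSa : 0 ≤ cS * F := mul_nonneg hcS hF0
  obtain ⟨r1, r2, r3, r4, r5⟩ := apriori_arith_src (Sh := cSβ * F) hB₀ hq hκ' hθ ha0 hnJ0 hnB0 hCβ0 hSa hJt hL1 hL2 hL4 hL5
  rw [← ha_def, ← hnJ_def, ← hnB_def, hJJ, ← hF_def]
  exact ⟨r1, r2, r3, r4, r5⟩

/-! ## §3 The family forms on the guarded letter (`B9SupplySockB9P3ZdAtJoint` §1–§2 with `GopAddAt` ↦ `LinBddAt`; same constants) -/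

/-- ★ **(`CurvAtInAk`; EXPLICIT CONSTANTS, SUPPLIED CLASS.)  THE `SB9all` FAMILY AT THE `Ω₀ = ℤᵈ` MEMBERS AT A MEMBER-WISE DATUM CLASS `ΛbP j`** — edition γ of
`B9SupplySockB9P3ZdAtJoint.sockB9P3_allLevels_univ_explicit_on` (binder `AvgAtP … (ΛbP j)`, socket `SockB9P3 … (ΛbP j)`).
[cite: Balaban1985RegularSpaces, (1.59) p.86, (1.31) p.82, p.77; Balaban1985BackgroundPropagators, Thm 3.3 p.399; Balaban1984PropagatorsII, (2.3) p.224] -/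
theorem sockB9P3PI_allLevels_univ_explicit_on (hd2 : 2 ≤ d) (hL : 1 ≤ L) {c35 c₆ K₆ M₃ a₃ c69 q CH β : ℝ} {len : Site d → ℝ}
    {M₁ δ₀ a₀ B₀ : ℝ} {Bβ Bε : ℝ → ℝ} {Bεβ : ℝ → ℝ → ℝ} (hB₀ : 0 < B₀)
    (H : ∀ i : I, M₁ ≤ (geo i).M → ∀ α₀ : ℝ, 0 < α₀ → (geo i).M * α₀ ≤ a₀ →
      ∀ U : (bg i).Cfg, (bg i).Reg335 c35 α₀ U →
        B9.Ineq342_346_347 (GA i) B₀ δ₀ U ∧ B9.Ineq343_345 (GA i) Bβ Bε Bεβ δ₀ U)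
    {M : ℝ} (hM1 : 1 ≤ M) (hMM₁ : M₁ ≤ M) (hMM₃ : M₃ ≤ M)
    {J : Type*} (ι : J → ZdIdx d L) (hΩJ : ∀ j, (ι j).Ω 0 = Set.univ)
    (hdict : ∀ (M : ℝ) (j : J) (m : ℕ), DictAt geo bg GA L mem ιCfg ιLoc ops M (ι j) m)
    (hP6 : ∀ (M : ℝ) (j : J) (m : ℕ), M₃ ≤ M → Prop6At bg L mem ιCfg c35 c₆ K₆ M (ι j) m)
    (hinv : ∀ (M : ℝ) (j : J) (m : ℕ), M₃ ≤ M → InvAt bg L mem ιCfg ops c35 a₃ M (ι j) m)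
    (hcurv : ∀ (M : ℝ) (j : J) (m : ℕ), M₃ ≤ M → CurvAtInAk L ops c69 M (ι j) m)
    (hlan : ∀ (M : ℝ) (j : J) (m : ℕ), M₃ ≤ M → LandauAt bg L mem ιCfg ops c35 a₃ M (ι j) m)
    (ΛbP : J → ℕ → ℕ → Set (Site d × Fin d)) (havg : ∀ (M : ℝ) (j : J) (m : ℕ), AvgAtP L ops q (ΛbP j) M (ι j) m)
    (hhol : ∀ (M : ℝ) (j : J) (m : ℕ), HolderAt geo bg GA L mem ιCfg ops β len CH M (ι j) m)
    (hK₆ : 0 < K₆) (hc69 : 0 ≤ c69) (hq : 0 ≤ q) :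
    ∀ (j : J) (m : ℕ), m ≤ (ι j).k →
      SockB9P3 (𝔸 := 𝔸) L (max 1 (2 * B₀ * max 1 q)) (2 * max 0 (CH * Bβ β) * max 1 q)
        (min (1 / 16) (min (c₆ / M) (min (a₀ / (K₆ * M)) (min (a₃ / (K₆ * M)) (1 / (2 * B₀ * c69 * M + 1))))))
        β len (ι j).η m (ι j).Ω (ι j).Λs (ΛbP j) := by
  intro j m _
  refine sockB9P3PI_at_univ geo bg GA L mem ιCfg ιLoc ops hd2 hL hM1 (ι j) (hΩJ j) m (hdict M j m) (hP6 M j m hMM₃) (hinv M j m hMM₃)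
    (hcurv M j m hMM₃) (hlan M j m hMM₃) (ΛbP j) (havg M j m) (hhol M j m) hK₆ hc69 hq
    (δ₀ := δ₀) (Bε := Bε) (Bεβ := Bεβ) hB₀ fun α₀ U₀ hU₀ hα₀ hMa hreg => ?_
  have hMi : M₁ ≤ (geo (mem M (ι j) m)).M := by rw [(hdict M j m).1]; exact hMM₁
  have hMa' : (geo (mem M (ι j) m)).M * α₀ ≤ a₀ := by rw [(hdict M j m).1]; exact hMa
  exact H (mem M (ι j) m) hMi α₀ hα₀ hMa' (ιCfg M (ι j) m U₀ hU₀) hreg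

/-- **(`CurvAtInAk`; GUARDED LETTER, EXPLICIT CONSTANTS, SUPPLIED CLASS.)  THE `SB9srcH` BODY AT THE `Ω₀ = ℤᵈ` MEMBERS AT A MEMBER-WISE DATUM CLASS `ΛbP j`** — edition γ of
`B9SupplySockB9P3ZdAtLin.sockB9P3srcH_univ_explicit_on_lin` (`|B₁|` over `ΛbP jj`). [cite: Balaban1985RegularSpaces, Thm 8 + (1.146) p.101, (1.59) p.86, (1.31) p.82; Balaban1985BackgroundPropagators, Thm 3.3 p.399; Balaban1984PropagatorsII, (2.3) p.224] -/
theorem sockB9P3srcHPI_univ_explicit_on_lin (hd2 : 2 ≤ d) (hL : 1 ≤ L) {c35 c₆ K₆ M₃ a₃ c69 q CH β cS cSβ : ℝ} {len : Site d → ℝ}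
    {M₁ δ₀ a₀ B₀ : ℝ} {Bβ Bε : ℝ → ℝ} {Bεβ : ℝ → ℝ → ℝ} (hB₀ : 0 < B₀)
    (H : ∀ i : I, M₁ ≤ (geo i).M → ∀ α₀ : ℝ, 0 < α₀ → (geo i).M * α₀ ≤ a₀ →
      ∀ U : (bg i).Cfg, (bg i).Reg335 c35 α₀ U →
        B9.Ineq342_346_347 (GA i) B₀ δ₀ U ∧ B9.Ineq343_345 (GA i) Bβ Bε Bεβ δ₀ U)
    {M : ℝ} (hM1 : 1 ≤ M) (hMM₁ : M₁ ≤ M) (hMM₃ : M₃ ≤ M)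
    {J : Type*} (ι : J → ZdIdx d L) (hΩJ : ∀ j, (ι j).Ω 0 = Set.univ)
    (hdict : ∀ (M : ℝ) (j : J) (m : ℕ), DictAt geo bg GA L mem ιCfg ιLoc ops M (ι j) m)
    (hP6 : ∀ (M : ℝ) (j : J) (m : ℕ), M₃ ≤ M → Prop6At bg L mem ιCfg c35 c₆ K₆ M (ι j) m)
    (hinv : ∀ (M : ℝ) (j : J) (m : ℕ), M₃ ≤ M → InvAt bg L mem ιCfg ops c35 a₃ M (ι j) m)
    (hcurv : ∀ (M : ℝ) (j : J) (m : ℕ), M₃ ≤ M → CurvAtInAk L ops c69 M (ι j) m)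
    (ΛbP : J → ℕ → ℕ → Set (Site d × Fin d)) (havg : ∀ (M : ℝ) (j : J) (m : ℕ), AvgAtP L ops q (ΛbP j) M (ι j) m)
    (hhol : ∀ (M : ℝ) (j : J) (m : ℕ), HolderAt geo bg GA L mem ιCfg ops β len CH M (ι j) m)
    (hlin : ∀ (M : ℝ) (j : J) (m : ℕ), LinBddAt L ops M (ι j) m)
    (hsrc : ∀ (M : ℝ) (j : J) (m : ℕ), M₃ ≤ M → SrcAt bg L mem ιCfg ops c35 a₃ cS M (ι j) m)
    (hsrcH : ∀ (M : ℝ) (j : J) (m : ℕ), M₃ ≤ M → SrcHolderAt bg L mem ιCfg ops c35 a₃ β len cSβ M (ι j) m)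
    (hK₆ : 0 < K₆) (hc69 : 0 ≤ c69) (hq : 0 ≤ q) (hcS : 0 ≤ cS) (hcSβ : 0 ≤ cSβ) (γ₈ : ℝ) :
    ∀ jj : J,
      ∀ α₀ α₁ α₂ : ℝ, 0 < α₀ → α₀ ≤ (min (1 / 16) (min (c₆ / M) (min (a₀ / (K₆ * M)) (min (a₃ / (K₆ * M)) (1 / (2 * B₀ * c69 * M + 1)))))) → 0 < α₁ → 0 < α₂ → α₂ ≤ (min (1 / 16) (min (c₆ / M) (min (a₀ / (K₆ * M)) (min (a₃ / (K₆ * M)) (1 / (2 * B₀ * c69 * M + 1)))))) →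
      ∀ (U₀ W : Site d → Fin d → 𝔸ˣ), (∀ x κ, U₀ x κ ∈ unitaryUnits 𝔸) → (∀ x κ, W x κ ∈ unitaryUnits 𝔸) →
      ∀ f : Site d → 𝔸, InR138 L (ι jj).k (ι jj).η ((ι jj).Ω 0) ((ι jj).Λs (ι jj).k) U₀ f →
      (∀ x, IsSelfAdjoint (f x)) → (∀ x, x ∉ (ι jj).Ω 0 → f x = 0) →
      Bdd L (ι jj).k (ι jj).η (-(2 : ℝ)) (fun j (x : Site d) => x ∈ (ι jj).Ω j) f →
      msup L (ι jj).k (ι jj).η (-(2 : ℝ)) (fun j (x : Site d) => x ∈ (ι jj).Ω j) f < γ₈ * (α₀ + α₁) →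
      msup L (ι jj).k (ι jj).η (-(3 : ℝ)) (fun j (p : Fin d × Site d) => p.2 ∈ (ι jj).Ω j) (fun p => covDerivFwd (ι jj).η U₀ p.1 f p.2) < γ₈ * (α₀ + α₁) →
      InAk L (ι jj).k (ι jj).η α₀ (ι jj).Ω U₀ → InAk L (ι jj).k (ι jj).η α₀ (ι jj).Ω (mulCfg W U₀) →
      IsLandau146W L (ι jj).k (ι jj).η ((ι jj).Ω 0) ((ι jj).Λs (ι jj).k) U₀ f W →
      ∀ A' : Site d → Fin d → 𝔸, (∀ y τ, IsSelfAdjoint (A' y τ)) →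
      (∀ j, j ≤ (ι jj).k → ∀ (y : Site d) (τ : Fin d), SideTouches ((ι jj).Ω j) y τ →
        W y τ = cfgExp (ι jj).η A' y τ ∧ ‖A' y τ‖ ≤ α₂ * ((L : ℝ) ^ j * (ι jj).η)⁻¹) →
      (∀ (y : Site d) (τ : Fin d), (∀ j, j ≤ (ι jj).k → ¬ SideTouches ((ι jj).Ω j) y τ) → A' y τ = 0) →
      msup L (ι jj).k (ι jj).η (-(1 : ℝ)) (fun j (b : Site d × Fin d) => SideTouches ((ι jj).Ω j) b.1 b.2) (fun b => A' b.1 b.2)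
          ≤ (max 1 (2 * B₀ * max 1 q)) * (bondNorm L (ι jj).k (ι jj).η (-(3 : ℝ)) (ι jj).Ω (fun x μ => Jcur (ι jj).η U₀ A' μ x)
            + wsup 1 (fun p : {p : ℕ × (Site d × Fin d) // p.1 ≤ (ι jj).k ∧ p.2 ∈ ΛbP jj (ι jj).k p.1} =>
                linCovIter L U₀ (iEta (ι jj).η A') p.1.1 p.1.2.1 p.1.2.2)) + (2 * cS * γ₈ / max 1 (2 * B₀ * max 1 q)) * (max 1 (2 * B₀ * max 1 q)) * (α₀ + α₁) ∧
        msup L (ι jj).k (ι jj).η (-(2 : ℝ)) (fun j (t : Fin d × Fin d × Site d) => SideTouches ((ι jj).Ω j) t.2.2 t.2.1)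
            (fun t => covDerivFwd (ι jj).η U₀ t.1 (fun z => A' z t.2.1) t.2.2)
          ≤ (max 1 (2 * B₀ * max 1 q)) * (bondNorm L (ι jj).k (ι jj).η (-(3 : ℝ)) (ι jj).Ω (fun x μ => Jcur (ι jj).η U₀ A' μ x)
            + wsup 1 (fun p : {p : ℕ × (Site d × Fin d) // p.1 ≤ (ι jj).k ∧ p.2 ∈ ΛbP jj (ι jj).k p.1} =>
                linCovIter L U₀ (iEta (ι jj).η A') p.1.1 p.1.2.1 p.1.2.2)) + (2 * cS * γ₈ / max 1 (2 * B₀ * max 1 q)) * (max 1 (2 * B₀ * max 1 q)) * (α₀ + α₁) ∧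
        bondNorm L (ι jj).k (ι jj).η (-(3 : ℝ)) (ι jj).Ω (fun x μ => pdiv (ι jj).η U₀ (plaqCovDeriv (ι jj).η U₀ A') μ x)
          ≤ (max 1 (2 * B₀ * max 1 q)) * (bondNorm L (ι jj).k (ι jj).η (-(3 : ℝ)) (ι jj).Ω (fun x μ => Jcur (ι jj).η U₀ A' μ x)
            + wsup 1 (fun p : {p : ℕ × (Site d × Fin d) // p.1 ≤ (ι jj).k ∧ p.2 ∈ ΛbP jj (ι jj).k p.1} =>
                linCovIter L U₀ (iEta (ι jj).η A') p.1.1 p.1.2.1 p.1.2.2)) + (2 * cS * γ₈ / max 1 (2 * B₀ * max 1 q)) * (max 1 (2 * B₀ * max 1 q)) * (α₀ + α₁) ∧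
        bondNorm L (ι jj).k (ι jj).η (-(3 : ℝ)) (ι jj).Ω (fun x μ => covLap (ι jj).η U₀ (fun z => A' z μ) x)
          ≤ (max 1 (2 * B₀ * max 1 q)) * (bondNorm L (ι jj).k (ι jj).η (-(3 : ℝ)) (ι jj).Ω (fun x μ => Jcur (ι jj).η U₀ A' μ x)
            + wsup 1 (fun p : {p : ℕ × (Site d × Fin d) // p.1 ≤ (ι jj).k ∧ p.2 ∈ ΛbP jj (ι jj).k p.1} =>
                linCovIter L U₀ (iEta (ι jj).η A') p.1.1 p.1.2.1 p.1.2.2)) + (2 * cS * γ₈ / max 1 (2 * B₀ * max 1 q)) * (max 1 (2 * B₀ * max 1 q)) * (α₀ + α₁) ∧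
        msup L (ι jj).k (ι jj).η (-(2 + β)) (fun j (q : Fin d × Fin d × (Site d × Site d)) => q.2.2 ∈ AdmPair (ι jj).η len ∧ q.2.2.1 ∈ (ι jj).Ω j)
            (fun q => hquot (ι jj).η β len U₀ (covDerivFwd (ι jj).η U₀ q.1 (fun z => A' z q.2.1)) q.2.2)
          ≤ (2 * max 0 (CH * Bβ β) * max 1 q) * (bondNorm L (ι jj).k (ι jj).η (-(3 : ℝ)) (ι jj).Ω (fun x μ => Jcur (ι jj).η U₀ A' μ x)
            + wsup 1 (fun p : {p : ℕ × (Site d × Fin d) // p.1 ≤ (ι jj).k ∧ p.2 ∈ ΛbP jj (ι jj).k p.1} =>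
                linCovIter L U₀ (iEta (ι jj).η A') p.1.1 p.1.2.1 p.1.2.2)) + ((max 0 (CH * Bβ β) * cS / B₀ + cSβ) * γ₈) * (α₀ + α₁) := by
  have hM0 : 0 < M := lt_of_lt_of_le one_pos hM1
  have hKM : 0 < K₆ * M := mul_pos hK₆ hM0
  obtain ⟨B', hB'_def⟩ : ∃ B' : ℝ, B' = max 1 (2 * B₀ * max 1 q) := ⟨_, rfl⟩
  have hB'1 : 1 ≤ B' := by rw [hB'_def]; exact le_max_left _ _
  have hB'0 : 0 < B' := lt_of_lt_of_le one_pos hB'1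
  have hCβ0 : 0 ≤ max 0 (CH * Bβ β) := le_max_left _ _
  rw [← hB'_def]
  intro jj α₀ α₁ α₂ hα₀ hα₀c hα₁ hα₂ hα₂c U₀ W hU₀ hWu f _ _ _ hfB hfF _ hInA _ hLW A' _ h41 hA0
  have hη : 0 < (ι jj).η := (ι jj).hη
  have hα₂16 : α₂ ≤ 1 / 16 := hα₂c.trans (min_le_left _ _)
  -- the multiplier clause for A′ = (iη)⁻¹ log W on every bond
  have hlog : ∀ (x : Site d) (μ : Fin d), BondTouches ((ι jj).Ω 0) x μ → logCfg (ι jj).η W x μ = A' x μ :=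
    fun x μ _ => B9SupplySockB9P3ZdSrc.logCfg_eq_of_univ L hd2 hη (hΩJ jj) U₀ hWu hα₂16 h41 x μ
  have hcl : ∃ μ : ℕ → Site d → 𝔸, ∀ x ∈ (ι jj).Ω 0,
      covLap (ι jj).η U₀ (((ι jj).Ω 0).indicator (covDivB (ι jj).η U₀ A' - f)) x = QT L (ι jj).k ((ι jj).Λs (ι jj).k) U₀ μ x :=
    (B9SupplySockB9P3ZdSrc.mulClause_congr f hlog).1 hLW.2
  have h33U : ∀ (α : ℝ) (V : Site d → Fin d → 𝔸ˣ) (hV : ∀ x κ, V x κ ∈ unitaryUnits 𝔸), 0 < α → M * α ≤ a₀ →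
      (bg (mem M (ι jj) (ι jj).k)).Reg335 c35 α (ιCfg M (ι jj) (ι jj).k V hV) →
      B9.Ineq342_346_347 (GA (mem M (ι jj) (ι jj).k)) B₀ δ₀ (ιCfg M (ι jj) (ι jj).k V hV) ∧
        B9.Ineq343_345 (GA (mem M (ι jj) (ι jj).k)) Bβ Bε Bεβ δ₀ (ιCfg M (ι jj) (ι jj).k V hV) := by
    intro α V hV hα hMa hreg
    have hMi : M₁ ≤ (geo (mem M (ι jj) (ι jj).k)).M := by rw [(hdict M jj (ι jj).k).1]; exact hMM₁
    have hMa' : (geo (mem M (ι jj) (ι jj).k)).M * α ≤ a₀ := by rw [(hdict M jj (ι jj).k).1]; exact hMa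
    exact H (mem M (ι jj) (ι jj).k) hMi α hα hMa' (ιCfg M (ι jj) (ι jj).k V hV) hreg
  obtain ⟨r1, r2, r3, r4, r5⟩ := sockSrc_core_at_univ_linPI geo bg GA L mem ιCfg ιLoc ops hL hM1 (ι jj) (hΩJ jj) (ι jj).k
    (hdict M jj _) (hP6 M jj _ hMM₃) (hinv M jj _ hMM₃) (hcurv M jj _ hMM₃) (ΛbP jj) (havg M jj _) (hhol M jj _) (hlin M jj _)
    (hsrc M jj _ hMM₃) (hsrcH M jj _ hMM₃) hK₆ hc69 hq hcS hcSβ hB₀ h33U α₀ α₂ hα₀ hα₀c hα₂ hα₂16 U₀ hU₀ hInA A'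
    (fun j hj y τ hs => (h41 j hj y τ hs).2) hA0 f hfB hcl
  rw [← hB'_def] at r1 r2 r3 r4
  -- the source allowance: 2c_S|f|₍₋₂₎ ≤ γ″B₀′(α₀ + α₁), (C_βc_S∕B₀ + c_Sβ)|f|₍₋₂₎ ≤ γβ(α₀ + α₁)
  obtain ⟨F, hF_def⟩ : ∃ F : ℝ, F = msup L (ι jj).k (ι jj).η (-(2 : ℝ)) (fun j (x : Site d) => x ∈ (ι jj).Ω j) f := ⟨_, rfl⟩
  rw [← hF_def] at r1 r2 r4 r5 hfF
  have hF0 : 0 ≤ F := by rw [hF_def]; exact B8ScaledSupNorm.msup_nonneg L _ hη.le _ _ _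
  have hS : 2 * (cS * F) ≤ 2 * cS * γ₈ / B' * B' * (α₀ + α₁) := by
    have h1 : cS * F ≤ cS * (γ₈ * (α₀ + α₁)) := mul_le_mul_of_nonneg_left hfF.le hcS
    have h2 : 2 * cS * γ₈ / B' * B' * (α₀ + α₁) = 2 * (cS * (γ₈ * (α₀ + α₁))) := by field_simp
    linarith
  have hSβ : max 0 (CH * Bβ β) * (cS * F) / B₀ + cSβ * F ≤ (max 0 (CH * Bβ β) * cS / B₀ + cSβ) * γ₈ * (α₀ + α₁) := by
    have h1 : cS * F ≤ cS * (γ₈ * (α₀ + α₁)) := mul_le_mul_of_nonneg_left hfF.le hcS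
    have h2 : max 0 (CH * Bβ β) * (cS * F) / B₀ ≤ max 0 (CH * Bβ β) * (cS * (γ₈ * (α₀ + α₁))) / B₀ :=
      div_le_div_of_nonneg_right (mul_le_mul_of_nonneg_left h1 hCβ0) hB₀.le
    have h3 : cSβ * F ≤ cSβ * (γ₈ * (α₀ + α₁)) := mul_le_mul_of_nonneg_left hfF.le hcSβ
    have h4 : (max 0 (CH * Bβ β) * cS / B₀ + cSβ) * γ₈ * (α₀ + α₁) =
        max 0 (CH * Bβ β) * (cS * (γ₈ * (α₀ + α₁))) / B₀ + cSβ * (γ₈ * (α₀ + α₁)) := by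
      field_simp
    linarith
  have hnn : 2 * (cS * F) ≤ 2 * cS * γ₈ / B' * B' * (α₀ + α₁) := hS
  exact ⟨r1.trans (by linarith), r2.trans (by linarith), r3.trans (le_add_of_nonneg_right (by linarith [mul_nonneg hcS hF0])),
    r4.trans (by linarith), r5.trans (by linarith)⟩

/-- **(`CurvAtInAk`; GUARDED LETTER, EXPLICIT CONSTANTS, SUPPLIED CLASS.)  THE `SH59src` BODY AT THE `Ω₀ = ℤᵈ` MEMBERS AT A MEMBER-WISE DATUM CLASS `ΛbP j`** — edition γ of
`B9SupplySockB9P3ZdAtLin.sockH59src_univ_explicit_on_lin` (`|B₁|` over `ΛbP jj`). [cite: Balaban1985RegularSpaces, Thm 8 + (1.146) p.101, (1.59) p.86, (1.31) p.82; Balaban1985BackgroundPropagators, Thm 3.3 p.399; Balaban1984PropagatorsII, (2.3) p.224] -/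
theorem sockH59srcPI_univ_explicit_on_lin (hd2 : 2 ≤ d) (hL : 1 ≤ L) {c35 c₆ K₆ M₃ a₃ c69 q CH β cS cSβ : ℝ} {len : Site d → ℝ}
    {M₁ δ₀ a₀ B₀ : ℝ} {Bβ Bε : ℝ → ℝ} {Bεβ : ℝ → ℝ → ℝ} (hB₀ : 0 < B₀)
    (H : ∀ i : I, M₁ ≤ (geo i).M → ∀ α₀ : ℝ, 0 < α₀ → (geo i).M * α₀ ≤ a₀ →
      ∀ U : (bg i).Cfg, (bg i).Reg335 c35 α₀ U →
        B9.Ineq342_346_347 (GA i) B₀ δ₀ U ∧ B9.Ineq343_345 (GA i) Bβ Bε Bεβ δ₀ U)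
    {M : ℝ} (hM1 : 1 ≤ M) (hMM₁ : M₁ ≤ M) (hMM₃ : M₃ ≤ M)
    {J : Type*} (ι : J → ZdIdx d L) (hΩJ : ∀ j, (ι j).Ω 0 = Set.univ)
    (hdict : ∀ (M : ℝ) (j : J) (m : ℕ), DictAt geo bg GA L mem ιCfg ιLoc ops M (ι j) m)
    (hP6 : ∀ (M : ℝ) (j : J) (m : ℕ), M₃ ≤ M → Prop6At bg L mem ιCfg c35 c₆ K₆ M (ι j) m)
    (hinv : ∀ (M : ℝ) (j : J) (m : ℕ), M₃ ≤ M → InvAt bg L mem ιCfg ops c35 a₃ M (ι j) m)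
    (hcurv : ∀ (M : ℝ) (j : J) (m : ℕ), M₃ ≤ M → CurvAtInAk L ops c69 M (ι j) m)
    (ΛbP : J → ℕ → ℕ → Set (Site d × Fin d)) (havg : ∀ (M : ℝ) (j : J) (m : ℕ), AvgAtP L ops q (ΛbP j) M (ι j) m)
    (hhol : ∀ (M : ℝ) (j : J) (m : ℕ), HolderAt geo bg GA L mem ιCfg ops β len CH M (ι j) m)
    (hlin : ∀ (M : ℝ) (j : J) (m : ℕ), LinBddAt L ops M (ι j) m)
    (hsrc : ∀ (M : ℝ) (j : J) (m : ℕ), M₃ ≤ M → SrcAt bg L mem ιCfg ops c35 a₃ cS M (ι j) m)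
    (hsrcH : ∀ (M : ℝ) (j : J) (m : ℕ), M₃ ≤ M → SrcHolderAt bg L mem ιCfg ops c35 a₃ β len cSβ M (ι j) m)
    (hK₆ : 0 < K₆) (hc69 : 0 ≤ c69) (hq : 0 ≤ q) (hcS : 0 ≤ cS) (hcSβ : 0 ≤ cSβ)
    (γ₈ : ℝ) {B₈ B₀'' : ℝ} (hB₈ : 0 < B₈) (hB₀'' : 0 ≤ B₀'') :
    ∀ jj : J,
      ∀ α₀ α₁ : ℝ, 0 < α₀ → 0 < α₁ → α₀ + α₁ ≤ min (min (1 / 16) (min (c₆ / M) (min (a₀ / (K₆ * M)) (min (a₃ / (K₆ * M)) (1 / (2 * B₀ * c69 * M + 1)))))) ((min (1 / 16) (min (c₆ / M) (min (a₀ / (K₆ * M)) (min (a₃ / (K₆ * M)) (1 / (2 * B₀ * c69 * M + 1)))))) / (2 * (L * (5 * (d : ℝ) * L * B₈)) + 8 * (8 * B₀'' * (5 * (d : ℝ) * L * B₈)))) →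
      ∀ U₀ U' : Site d → Fin d → 𝔸ˣ, (∀ x κ, U₀ x κ ∈ unitaryUnits 𝔸) → (∀ x κ, U' x κ ∈ unitaryUnits 𝔸) →
      ∀ φ : Site d → 𝔸, ((InR138 L (ι jj).k (ι jj).η ((ι jj).Ω 0) ((ι jj).Λs (ι jj).k) U₀ φ ∧ (∀ x, IsSelfAdjoint (φ x)) ∧
          (∀ x, x ∉ (ι jj).Ω 0 → φ x = 0) ∧ Bdd L (ι jj).k (ι jj).η (-(2 : ℝ)) (fun j (x : Site d) => x ∈ (ι jj).Ω j) φ) ∧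
        msup L (ι jj).k (ι jj).η (-(2 : ℝ)) (fun j (x : Site d) => x ∈ (ι jj).Ω j) φ < γ₈ * (α₀ + α₁)) →
      InAk L (ι jj).k (ι jj).η α₀ (ι jj).Ω U₀ → InAk L (ι jj).k (ι jj).η α₀ (ι jj).Ω (mulCfg U' U₀) →
      (∀ m, m ≤ (ι jj).k → InAx L m ((ι jj).Λs m) U₀ (mulCfg U' U₀)) →
      (∀ j, j ≤ (ι jj).k → ∀ (z : Site d) (μ : Fin d), (∀ x, InBox (loK L j z) (bondHiK L j z μ) x → x ∈ (ι jj).Ω j) →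
        ‖(avgIter L (mulCfg U' U₀) j z μ : 𝔸) - (avgIter L U₀ j z μ : 𝔸)‖ ≤ α₁) →
      (∀ b ∈ {b : Site d × Fin d | SideTouches ((ι jj).Ω 0) b.1 b.2}, ‖((U' b.1 b.2 : 𝔸ˣ) : 𝔸) - 1‖ ≤ α₁) →
      (∀ m, 1 ≤ m → m ≤ (ι jj).k → ∀ (u : Site d → 𝔸ˣ) (W : Site d → Fin d → 𝔸ˣ) (A' : Site d → Fin d → 𝔸),
        (∀ x, u x ∈ unitaryUnits 𝔸) → mgauge U₀ u W = U' → Restr129 L m ((ι jj).Λs m) U₀ u →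
        LanF146 L (ι jj).k (ι jj).η ((ι jj).Ω 0) (ι jj).Λs U₀ φ m W →
        (∀ y τ, IsSelfAdjoint (A' y τ)) →
        (∀ j, j ≤ m → ∀ y τ, SideTouches ((ι jj).Ω j) y τ →
        W y τ = cfgExp (ι jj).η A' y τ ∧ ‖A' y τ‖ ≤ (2 * (L * (5 * (d : ℝ) * L * B₈ * (α₀ + α₁))) + 8 * (8 * B₀'' * (5 * (d : ℝ) * L * B₈) * (α₀ + α₁))) * ((L : ℝ) ^ j * (ι jj).η)⁻¹) →
        (∀ y τ, (∀ j, j ≤ m → ¬ SideTouches ((ι jj).Ω j) y τ) → A' y τ = 0) →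
        msup L m (ι jj).η (-(1 : ℝ)) (fun j (b : Site d × Fin d) => SideTouches ((ι jj).Ω j) b.1 b.2) (fun b => A' b.1 b.2)
        ≤ (max 1 (2 * B₀ * max 1 q)) * (bondNorm L m (ι jj).η (-(3 : ℝ)) (ι jj).Ω (fun x μ => Jcur (ι jj).η U₀ A' μ x)
        + wsup 1 (fun p : {p : ℕ × (Site d × Fin d) // p.1 ≤ m ∧ p.2 ∈ ΛbP jj m p.1} =>
        linCovIter L U₀ (iEta (ι jj).η A') p.1.1 p.1.2.1 p.1.2.2)) + (2 * cS * γ₈ / max 1 (2 * B₀ * max 1 q)) * (max 1 (2 * B₀ * max 1 q)) * (α₀ + α₁) ∧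
        msup L m (ι jj).η (-(2 : ℝ)) (fun j (t : Fin d × Fin d × Site d) => SideTouches ((ι jj).Ω j) t.2.2 t.2.1)
        (fun t => covDerivFwd (ι jj).η U₀ t.1 (fun z => A' z t.2.1) t.2.2)
        ≤ (max 1 (2 * B₀ * max 1 q)) * (bondNorm L m (ι jj).η (-(3 : ℝ)) (ι jj).Ω (fun x μ => Jcur (ι jj).η U₀ A' μ x)
        + wsup 1 (fun p : {p : ℕ × (Site d × Fin d) // p.1 ≤ m ∧ p.2 ∈ ΛbP jj m p.1} =>
        linCovIter L U₀ (iEta (ι jj).η A') p.1.1 p.1.2.1 p.1.2.2)) + (2 * cS * γ₈ / max 1 (2 * B₀ * max 1 q)) * (max 1 (2 * B₀ * max 1 q)) * (α₀ + α₁)) := by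
  have hM0 : 0 < M := lt_of_lt_of_le one_pos hM1
  have hKM : 0 < K₆ * M := mul_pos hK₆ hM0
  have hL' : (1 : ℝ) ≤ L := by exact_mod_cast hL
  have hd' : (1 : ℝ) ≤ d := by exact_mod_cast (le_trans (by norm_num) hd2 : 1 ≤ d)
  obtain ⟨B', hB'_def⟩ : ∃ B' : ℝ, B' = max 1 (2 * B₀ * max 1 q) := ⟨_, rfl⟩
  have hB'1 : 1 ≤ B' := by rw [hB'_def]; exact le_max_left _ _
  have hB'0 : 0 < B' := lt_of_lt_of_le one_pos hB'1
  obtain ⟨cP, hcP_def⟩ : ∃ cP : ℝ,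
      cP = min (1 / 16) (min (c₆ / M) (min (a₀ / (K₆ * M)) (min (a₃ / (K₆ * M)) (1 / (2 * B₀ * c69 * M + 1))))) := ⟨_, rfl⟩
  set K₀ : ℝ := (2 * (L * (5 * (d : ℝ) * L * B₈)) + 8 * (8 * B₀'' * (5 * (d : ℝ) * L * B₈))) with hK₀_def
  have hK₀ : 0 < K₀ := by
    have h1 : 0 < 2 * (L * (5 * (d : ℝ) * L * B₈)) := by positivity
    have h2 : 0 ≤ 8 * (8 * B₀'' * (5 * (d : ℝ) * L * B₈)) := by positivity
    linarith
  rw [← hB'_def, ← hcP_def]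
  intro jj α₀ α₁ hα₀ hα₁ hs U₀ U' hU₀ hU' φ hφ hInA _ _ _ _ m _ hmk u W A' hu hW _ hLanF _ h41 hA0
  obtain ⟨⟨-, -, -, hφB⟩, hφF⟩ := hφ
  have hη : 0 < (ι jj).η := (ι jj).hη
  -- the smallness constant of the datum and the guard of the level-`m` socket
  set K : ℝ := 2 * (L * (5 * (d : ℝ) * L * B₈ * (α₀ + α₁))) + 8 * (8 * B₀'' * (5 * (d : ℝ) * L * B₈) * (α₀ + α₁)) with hK_def
  have hKK₀ : K = K₀ * (α₀ + α₁) := by rw [hK_def, hK₀_def]; ring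
  have hS0 : 0 < α₀ + α₁ := add_pos hα₀ hα₁
  have hKpos : 0 < K := by rw [hKK₀]; exact mul_pos hK₀ hS0
  have hα₀P : α₀ ≤ cP := by linarith only [hα₁, hs, min_le_left cP (cP / K₀)]
  have hKP : K ≤ cP := by
    have h1 : α₀ + α₁ ≤ cP / K₀ := hs.trans (min_le_right _ _)
    calc K = K₀ * (α₀ + α₁) := hKK₀
      _ ≤ K₀ * (cP / K₀) := mul_le_mul_of_nonneg_left h1 hK₀.le
      _ = cP := by field_simp
  have hK16 : K ≤ 1 / 16 := hKP.trans (by rw [hcP_def]; exact min_le_left _ _)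
  rw [hcP_def] at hα₀P
  -- the datum is a datum of the sourced core at level `m`
  have hWu : ∀ x κ, W x κ ∈ unitaryUnits 𝔸 := mem_unitaryUnits_of_mgauge_eq hU₀ hU' hu hW
  have hInAm : InAk L m (ι jj).η α₀ (ι jj).Ω U₀ := fun j hj => hInA j (hj.trans hmk)
  have hlog : ∀ (x : Site d) (μ : Fin d), BondTouches ((ι jj).Ω 0) x μ → logCfg (ι jj).η W x μ = A' x μ :=
    fun x μ _ => B9SupplySockB9P3ZdSrc.logCfg_eq_of_univ L hd2 hη (hΩJ jj) U₀ hWu hK16 h41 x μ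
  have hcl : ∃ μ : ℕ → Site d → 𝔸, ∀ x ∈ (ι jj).Ω 0,
      covLap (ι jj).η U₀ (((ι jj).Ω 0).indicator (covDivB (ι jj).η U₀ A' - φ)) x = QT L m ((ι jj).Λs m) U₀ μ x :=
    (B9SupplySockB9P3ZdSrc.mulClause_congr φ hlog).1 hLanF.1
  have h33U : ∀ (α : ℝ) (V : Site d → Fin d → 𝔸ˣ) (hV : ∀ x κ, V x κ ∈ unitaryUnits 𝔸), 0 < α → M * α ≤ a₀ →
      (bg (mem M (ι jj) m)).Reg335 c35 α (ιCfg M (ι jj) m V hV) →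
      B9.Ineq342_346_347 (GA (mem M (ι jj) m)) B₀ δ₀ (ιCfg M (ι jj) m V hV) ∧
        B9.Ineq343_345 (GA (mem M (ι jj) m)) Bβ Bε Bεβ δ₀ (ιCfg M (ι jj) m V hV) := by
    intro α V hV hα hMa hreg
    have hMi : M₁ ≤ (geo (mem M (ι jj) m)).M := by rw [(hdict M jj m).1]; exact hMM₁
    have hMa' : (geo (mem M (ι jj) m)).M * α ≤ a₀ := by rw [(hdict M jj m).1]; exact hMa
    exact H (mem M (ι jj) m) hMi α hα hMa' (ιCfg M (ι jj) m V hV) hreg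
  obtain ⟨r1, r2, -, -, -⟩ := sockSrc_core_at_univ_linPI geo bg GA L mem ιCfg ιLoc ops hL hM1 (ι jj) (hΩJ jj) m
    (hdict M jj _) (hP6 M jj _ hMM₃) (hinv M jj _ hMM₃) (hcurv M jj _ hMM₃) (ΛbP jj) (havg M jj _) (hhol M jj _) (hlin M jj _)
    (hsrc M jj _ hMM₃) (hsrcH M jj _ hMM₃) hK₆ hc69 hq hcS hcSβ hB₀ h33U α₀ K hα₀ hα₀P hKpos hK16 U₀ hU₀ hInAm A'
    (fun j hj y τ hs' => (h41 j hj y τ hs').2) hA0 φ hφB hcl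
  rw [← hB'_def] at r1 r2
  obtain ⟨F, hF_def⟩ : ∃ F : ℝ, F = msup L (ι jj).k (ι jj).η (-(2 : ℝ)) (fun j (x : Site d) => x ∈ (ι jj).Ω j) φ := ⟨_, rfl⟩
  rw [← hF_def] at r1 r2 hφF
  have hS : 2 * (cS * F) ≤ 2 * cS * γ₈ / B' * B' * (α₀ + α₁) := by
    have h1 : cS * F ≤ cS * (γ₈ * (α₀ + α₁)) := mul_le_mul_of_nonneg_left hφF.le hcS
    have h2 : 2 * cS * γ₈ / B' * B' * (α₀ + α₁) = 2 * (cS * (γ₈ * (α₀ + α₁))) := by field_simp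
    linarith
  exact ⟨r1.trans (by linarith), r2.trans (by linarith)⟩

end Supply

/-! ## §5 The A6 witness: the TEN-letter hypothesis set of `sockSrc_core_at_univ_linPI` at truncation `0`, by `opsU` alone -/

section Main

open B9SupplySockB9P3ZdBeta.Witness (massA bgW)
open B9SupplySockB9P3ZdUnivWitness

variable {𝔸₀ : Type} [CStarAlgebra 𝔸₀] [Nontrivial 𝔸₀]
variable {L : ℕ}

/-- ★★ **A6 WITNESS, EDITION γ OF THE SOURCED `ℤᵈ` ROAD: THE HYPOTHESIS SET OF `sockSrc_core_at_univ_linPI` IS INHABITED AT EVERY MEMBER WITH `Ω 0 = ℤᵈ`, TRUNCATION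
`m = 0`, FOR EVERY DATUM CLASS `ΛbP` WHOSE LEVEL-`0` SET AT TRUNCATION `0` IS ALL BONDS** (`d ≥ 2`, `0 ≤ β < 1`, a length with «non-zero admissible displacement
⇒ ≥ 1»; any nontrivial C⋆-algebra `𝔸₀ : Type`): `DictAt ∧ Prop6At ∧ InvAt ∧ CurvAt ∧ LandauAt ∧ AvgAtP … ΛbP ∧ HolderAt ∧ LinBddAt ∧ SrcAt ∧ SrcHolderAt` at
`(1, i, 0)` and BOTH blocks of Theorem 3.3 — `B9SupplySockB9P3ZdAtLin.binders_inhabited_univ_zero_lin` VERBATIM with the class a parameter (letters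
`B9SupplySockB9P3ZdUnivWitness.opsU`, frame `geoU ∕ bgW ∕ GAU`, by import).  Print's class at truncation `0` (every bond has an end-point in `Λ₀^{(0)} = ℤᵈ`)
qualifies. [cite: Balaban1985BackgroundPropagators, Thm 3.3 p.399, (3.20)–(3.27) pp.394–395, (3.47) p.398, (3.16) p.393; Balaban1985RegularSpaces, Thm 8 + (1.146) p.101, (1.58)–(1.59) p.86, (1.31) p.82, p.77; Balaban1984PropagatorsII, (2.3) p.224] -/
theorem binders_inhabited_univ_zero_linPI (hd2 : 2 ≤ d) (i : ZdIdx d L) (hΩ : i.Ω 0 = Set.univ)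
    (ΛbP : ℕ → ℕ → Set (Site d × Fin d)) (hΛb : ∀ b : Site d × Fin d, b ∈ ΛbP 0 0) {β : ℝ} (hβ0 : 0 ≤ β) (hβ1 : β < 1) {len : Site d → ℝ}
    (hlen : ∀ v : Site d, 0 < len v → 1 ≤ len v) :
    ∃ (I : Type) (geo : I → B9.Geometry) (bg : I → B9.Backgrounds) (GA : ∀ x, B9.KernelFamily (geo x) (bg x))
      (mem : ℝ → ZdIdx d L → ℕ → I)
      (ιCfg : ∀ (M : ℝ) (i' : ZdIdx d L) (m : ℕ) (U₀ : Site d → Fin d → 𝔸₀ˣ), (∀ x κ, U₀ x κ ∈ unitaryUnits 𝔸₀) → (bg (mem M i' m)).Cfg)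
      (ιLoc : ∀ (M : ℝ) (i' : ZdIdx d L) (m : ℕ), (Site d → Fin d → 𝔸₀) → (geo (mem M i' m)).Loc)
      (ops : ℝ → ZdIdx d L → ℕ → OpsZd d 𝔸₀) (c35 c₆ K₆ a₃ c69 q CH cS cSβ B₀ δ₀ a₀ : ℝ) (Bβ Bε : ℝ → ℝ) (Bεβ : ℝ → ℝ → ℝ),
      0 < K₆ ∧ 0 ≤ c69 ∧ 0 ≤ q ∧ 0 ≤ cS ∧ 0 ≤ cSβ ∧ 0 < B₀ ∧ 0 < c₆ ∧ 0 < a₃ ∧ 0 < a₀ ∧ 0 ≤ CH ∧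
      DictAt geo bg GA L mem ιCfg ιLoc ops 1 i 0 ∧ Prop6At bg L mem ιCfg c35 c₆ K₆ 1 i 0 ∧ InvAt bg L mem ιCfg ops c35 a₃ 1 i 0 ∧
      CurvAtInAk L ops c69 1 i 0 ∧ LandauAt bg L mem ιCfg ops c35 a₃ 1 i 0 ∧ AvgAtP L ops q ΛbP 1 i 0 ∧
      HolderAt geo bg GA L mem ιCfg ops β len CH 1 i 0 ∧ LinBddAt L ops 1 i 0 ∧ SrcAt bg L mem ιCfg ops c35 a₃ cS 1 i 0 ∧
      SrcHolderAt bg L mem ιCfg ops c35 a₃ β len cSβ 1 i 0 ∧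
      (∀ (α₀ : ℝ) (U₀ : Site d → Fin d → 𝔸₀ˣ) (hU₀ : ∀ x κ, U₀ x κ ∈ unitaryUnits 𝔸₀), 0 < α₀ → 1 * α₀ ≤ a₀ →
        (bg (mem 1 i 0)).Reg335 c35 α₀ (ιCfg 1 i 0 U₀ hU₀) →
        B9.Ineq342_346_347 (GA (mem 1 i 0)) B₀ δ₀ (ιCfg 1 i 0 U₀ hU₀) ∧
          B9.Ineq343_345 (GA (mem 1 i 0)) Bβ Bε Bεβ δ₀ (ιCfg 1 i 0 U₀ hU₀)) := by
  classical
  have hd : 1 ≤ d := le_trans one_le_two hd2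
  have hη : 0 < i.η := i.hη
  have hdpos : (0 : ℝ) < d := by exact_mod_cast hd
  have ha : 0 < massA d i.η := by unfold massA; positivity
  have hbt : ∀ (y : Site d) (τ : Fin d), BondTouches (i.Ω 0) y τ := fun y τ => Or.inl (by rw [hΩ]; trivial)
  -- the value of G(U₀) at the ZERO source (the source term `G(U₀)DRD*A` of the witness, `DRD* := 0`)
  have hG0 : ∀ (U₀ : Site d → Fin d → 𝔸₀ˣ), (∀ x κ, U₀ x κ ∈ unitaryUnits 𝔸₀) →
      (opsU hd i.η hη).Gop U₀ (fun _ _ => (0 : 𝔸₀)) = fun _ _ => 0 := by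
    intro U₀ hU₀
    have hb0 : BddF (fun (_ : Site d) (_ : Fin d) => (0 : 𝔸₀)) := ⟨0, fun _ _ => by simp⟩
    have hr : restrU (fun (_ : Site d) (_ : Fin d) => (0 : 𝔸₀)) = 0 := by
      ext b; rw [restrU_apply hb0]; rfl
    rw [opsU_Gop hd hη hU₀, hr, fpU_zero hd hη hU₀, extdU_zero]; rfl
  refine ⟨Unit, fun _ => geoU i, fun _ => bgW d 𝔸₀, fun _ => GAU i hd, fun _ _ _ => (), fun _ _ _ U₀ _ => U₀, fun _ _ _ J => J,
    fun _ _ _ => opsU hd i.η i.hη, 0, 1, 1, 1, 0, massA d i.η * i.η ^ 2, 1, 0, 0, 1, 0, 1, fun _ => 1, fun _ => 1, fun _ _ => 1,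
    one_pos, le_rfl, by positivity, le_rfl, le_rfl, one_pos, one_pos, one_pos, one_pos, zero_le_one, ?_, ?_, ?_, ?_, ?_, ?_, ?_, ?_, ?_, ?_, ?_⟩
  · -- the norm dictionary: by construction of the frame
    refine ⟨rfl, fun U₀ hU₀ J => ⟨?_, ?_, ?_, ?_⟩⟩
    · rw [(geoU_readings i).2.2.2.2.2.2, if_pos rfl]
    · rw [(GAU_readings i hd).2.2.2.2.2, if_pos rfl]; simp [globU]
    · rw [(GAU_readings i hd).2.2.2.2.2, if_pos rfl]; simp [globU]
    · rw [(GAU_readings i hd).2.2.2.2.2, if_pos rfl]; simp [globU]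
  · -- Proposition 6's class: `Reg335 := ⊤`
    intro _ _ _ _ _ _; trivial
  · -- (3.27): G(U₀) is a left inverse of Δ_a(U₀) = D*_{U₀}D_{U₀} + a on E(ℤᵈ) = the bounded fields
    intro α₀ U₀ hU₀ _ _ _ A hA J hJ
    obtain ⟨c, hc⟩ := hA.2
    have e1 : (-(1 : ℝ)) = -((1 : ℕ) : ℝ) := by norm_num
    have hw1 : weight L i.η (-(1 : ℝ)) 0 = i.η := by rw [e1, B8ScaledSupNorm.weight_neg_natCast, pow_zero, one_mul, pow_one]
    have hAb : BddF A := by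
      refine ⟨c / i.η, fun y τ => ?_⟩
      have h := hc 0 le_rfl (y, τ) (sideTouches_univ i hd2 hΩ y τ)
      rw [hw1] at h
      rw [le_div_iff₀ hη, mul_comm]; exact h
    have hJ' : ∀ (y : Site d) (τ : Fin d), J y τ = Jcur i.η U₀ A τ y + (massA d i.η : ℂ) • A y τ := by
      intro y τ
      rw [hJ y τ (hbt y τ)]
      simp [deltaAOf, opsU]
    have hfix := fpU_unique hd hη hU₀ (restrU J) (phiU_restr_of_eq hd hη hU₀ hAb hJ')
    show (opsU hd i.η i.hη).Gop U₀ J = A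
    rw [opsU_Gop hd hη hU₀, ← hfix, extdU_restrU hAb]
  · -- (3.69): `Δ′ := 0`
    intro α₀ U₀ hU₀ hα₀ _ A _ j _ x μ _
    show ((L : ℝ) ^ j * i.η) ^ 3 * ‖(0 : 𝔸₀)‖ ≤ 0 * 1 * α₀ * _
    simp
  · -- the Landau letter: `DRD* := 0`
    intro _ _ _ _ _ _ _ _ _ _ _; rfl
  · -- (3.16): `Q*aQ := a·1`, `q := aη²`; every bond is a level-0 constraint bond at truncation 0
    intro U₀ hU₀ A hA j hj x μ hb
    obtain rfl : j = 0 := Nat.le_zero.mp hj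
    show ((L : ℝ) ^ 0 * i.η) ^ 3 * ‖(massA d i.η : ℂ) • A x μ‖ ≤ _
    obtain ⟨c, hc⟩ := hA.2
    have e1 : (-(1 : ℝ)) = -((1 : ℕ) : ℝ) := by norm_num
    have hw1 : weight L i.η (-(1 : ℝ)) 0 = i.η := by rw [e1, B8ScaledSupNorm.weight_neg_natCast, pow_zero, one_mul, pow_one]
    have hnormA : ∀ (y : Site d) (τ : Fin d), i.η * ‖A y τ‖ ≤ c := fun y τ => by
      have := hc 0 le_rfl (y, τ) (sideTouches_univ i hd2 hΩ y τ); rwa [hw1] at this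
    have hbd : ∀ p : {p : ℕ × (Site d × Fin d) // p.1 ≤ 0 ∧ p.2 ∈ ΛbP 0 p.1},
        1 * ‖linCovIter L U₀ (iEta i.η A) p.1.1 p.1.2.1 p.1.2.2‖ ≤ c := by
      rintro ⟨⟨j', b⟩, hj', -⟩
      obtain rfl : j' = 0 := Nat.le_zero.mp hj'
      dsimp only
      rw [one_mul, B7Prop4GeneralLevels.linCovIter_zero, iEta, norm_smul, norm_mul, Complex.norm_I, one_mul, Complex.norm_real,
        Real.norm_of_nonneg hη.le]
      exact hnormA b.1 b.2
    have hle := B8Eq155JBound.le_wsup hbd ⟨(0, (x, μ)), le_rfl, hΛb (x, μ)⟩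
    dsimp only at hle
    rw [one_mul, B7Prop4GeneralLevels.linCovIter_zero, iEta, norm_smul, norm_mul, Complex.norm_I, one_mul, Complex.norm_real,
      Real.norm_of_nonneg hη.le] at hle
    rw [pow_zero, one_mul, norm_smul, Complex.norm_real, Real.norm_of_nonneg ha.le]
    calc i.η ^ 3 * (massA d i.η * ‖A x μ‖) = (massA d i.η * i.η ^ 2) * (i.η * ‖A x μ‖) := by ring
      _ ≤ (massA d i.η * i.η ^ 2) * _ := mul_le_mul_of_nonneg_left hle (by positivity)
  · -- the Hölder binder: (3.43)'s block pins `Bβ β ≥ 1`; the crude quotient bound gives `≤ |J|₍₋₃₎`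
    intro Bβ Bε Bεβ δ₀ U₀ hU₀ h343 J
    have hB : 1 ≤ Bβ β := one_le_of_ineq343 i hd h343 hβ0 hβ1
    have hW0 : 0 ≤ bondNorm L 0 i.η (-(3 : ℝ)) i.Ω J := B8ScaledSupNorm.msup_nonneg L 0 hη.le _ _ _
    calc _ ≤ bondNorm L 0 i.η (-(3 : ℝ)) i.Ω J := holder_line i hd hΩ hβ0 hlen hU₀ J
      _ = 1 * 1 * bondNorm L 0 i.η (-(3 : ℝ)) i.Ω J := by ring
      _ ≤ 1 * Bβ β * bondNorm L 0 i.η (-(3 : ℝ)) i.Ω J := by gcongr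
  · -- ★ the guarded letter: `G(U₀)` additive on BOUNDED sources (`opsU_Gop_add_of_bdd`), and `DRD* := 0` is bounded
    exact ⟨fun U₀ hU₀ J₁ J₂ h₁ h₂ => opsU_Gop_add_of_bdd hd hη hU₀ h₁ h₂,
      fun U₀ _ A _ => ⟨0, fun x μ => by rw [show (opsU hd i.η i.hη).DRDs U₀ A x μ = (0 : 𝔸₀) from rfl, norm_zero]⟩⟩
  · -- the source term through `G(U₀)DRD*A = G(U₀)0 = 0`: every line is `0 ≤ 0·|f|`
    intro α₀ U₀ hU₀ _ _ _ A _ f _ _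
    have hz := hG0 U₀ hU₀
    simp only [show (fun z κ => (opsU hd i.η i.hη).DRDs U₀ A z κ) = fun _ _ => (0 : 𝔸₀) from rfl, hz]
    refine ⟨⟨0, fun y τ => by simp⟩, ?_, ?_, ?_⟩
    · rw [zero_mul]
      exact B8ScaledSupNorm.msup_le le_rfl fun j hj b _ => by rw [norm_zero, mul_zero]
    · rw [zero_mul]
      exact B8ScaledSupNorm.msup_le le_rfl fun j hj t _ => by rw [covDerivFwd_zero_fun, norm_zero, mul_zero]
    · rw [zero_mul]
      refine B8ScaledSupNorm.msup_le le_rfl fun j hj b _ => ?_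
      have hU1 : ∀ y κ, U₀ y κ ∈ U1 𝔸₀ := fun y κ => unitaryUnits_le_U1 (hU₀ y κ)
      have h0 : ‖covLap i.η U₀ (fun _ => (0 : 𝔸₀)) b.1‖ ≤ 0 := by
        have := B9SupplySockB9P3ZdLettersOmega.norm_covLap_le hη hU1 (f := fun _ => (0 : 𝔸₀)) (s := 0) (fun _ => by simp) b.1
        simpa using this
      rw [le_antisymm h0 (norm_nonneg _), mul_zero]
  · -- the Hölder line of the source term: quotients of the zero field vanish
    intro α₀ U₀ hU₀ _ _ _ A _ f _ _
    have hz := hG0 U₀ hU₀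
    simp only [show (fun z κ => (opsU hd i.η i.hη).DRDs U₀ A z κ) = fun _ _ => (0 : 𝔸₀) from rfl, hz]
    have hq0 : ∀ q : Fin d × Fin d × (Site d × Site d),
        hquot i.η β len U₀ (covDerivFwd i.η U₀ q.1 fun _ => (0 : 𝔸₀)) q.2.2 = 0 := by
      intro q
      have : (covDerivFwd i.η U₀ q.1 fun _ => (0 : 𝔸₀)) = fun _ => 0 := funext fun y => covDerivFwd_zero_fun i.η U₀ q.1 y
      rw [this, hquot_zero_fun]
    refine ⟨⟨0, fun j hj q _ => by simp only [hq0, norm_zero, mul_zero, le_refl]⟩, ?_⟩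
    rw [zero_mul]
    exact B8ScaledSupNorm.msup_le le_rfl fun j hj q _ => by simp only [hq0, norm_zero, mul_zero, le_refl]
  · -- Theorem 3.3's two blocks for G(U₀): local entries as designed, the γ = −3 globals by `globU_bounds`
    intro α₀ U₀ hU₀ _ _ _
    have hpref4 : ∀ (n : Fin 4) (t : ℝ), 0 ≤ t → 0 ≤ B9.pref4 t n := fun n t ht => by
      fin_cases n <;> simp [B9.pref4] <;> positivity
    obtain ⟨gsup, gl2, ghol, gdist, gcutH, gcutSup, gw⟩ := geoU_readings (𝔸₀ := 𝔸₀) i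
    obtain ⟨Ge, Gh1, Ge4, Gh2, Gl2, Gglob⟩ := GAU_readings (𝔸₀ := 𝔸₀) i hd
    refine ⟨⟨fun n lam y y' _ => ?_, fun n lam h y y' _ _ => ?_, fun n lam γ _ _ => ?_⟩, ⟨?_, ?_, ?_⟩⟩
    · rw [Ge, geoU_len, gdist, gsup, mul_zero, neg_zero, Real.exp_zero, mul_one, mul_one, one_mul]
      exact hpref4 n i.η hη.le
    · rw [Gl2, gcutSup, mul_zero, zero_mul, zero_mul]
    · by_cases hγ : γ = -3
      · rw [Gglob, gw, if_pos hγ, if_pos hγ, one_mul]; exact globU_bounds i hd hΩ hU₀ lam n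
      · rw [Gglob, gw, if_neg hγ, if_neg hγ, mul_zero]
    · intro β' lam ζ y y' _ _ _ _
      rw [Gh1, geoU_len, gcutH, gdist, gsup, mul_zero, neg_zero, Real.exp_zero, mul_one, mul_one, mul_one, one_mul]
    · intro ε lam y y' _ _ _
      rw [Ge4, gdist, ghol, gsup, mul_zero, neg_zero, Real.exp_zero, zero_add, mul_one, mul_one]
      exact zero_le_one
    · intro ε β' lam ζ y y' _ _ _ _ _ _
      rw [Gh2, geoU_len, gcutH, gdist, ghol, gsup, mul_zero, neg_zero, Real.exp_zero, zero_add, mul_one, mul_one, mul_one, one_mul]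
      exact Real.rpow_nonneg hη.le _


end Main

end Literature.MathematicalPhysics.QuantumFieldTheory.Balaban1983to89.B9SupplySockB9P3ZdGammaUnivInAk

end
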